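import Literature.Analysis.FluidPDE.TorusNSStrainProjectionCriterion
import HarnessLib

/-!
# Miller's strain self-amplification model on the torus: the enstrophy identity, the monotone
# functional `−3‖S‖²_{Ḣ¹} − 4∫det S`, and finite-time blow-up (Anal. PDE 16 (2023), §§4–5)

Analysis/FluidPDE file (one definition with body + fully proved theorems; no named facts).
Search for candidate a priori estimates; no regularity claim — this file types Miller's MODEL
equation and its blow-up exactly as printed; it says nothing about Navier–Stokes itself beyond the
printed moral (Rem. 1.12: "the identity for enstrophy growth and the strain constraint space are not
sufficient on their own to guarantee global regularity").

E. Miller, *Finite-time blowup for a Navier–Stokes model equation for the self-amplification of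
strain*, Anal. PDE 16 (2023) 997–1032 = arXiv:1910.05415. The **strain self-amplification model
equation** (1.19)/(4.1) is `∂ₜS − ΔS + ⅔P_{st}(S²) = 0` on the strain space `L²_{st}`, obtained from the
Navier–Stokes strain equation `∂ₜS − ΔS + P_{st}((u·∇)S + S² + ¼ω⊗ω) = 0` by dropping
`P_{st}((u·∇)S + ⅓S² + ¼ω⊗ω)`, which is `L²`-orthogonal to `S` (Prop 1.5). Printed results typed here:

* **Prop 4.3** (the model "has the same identity for enstrophy growth as the Navier–Stokes strain
  equation"): `∂ₜ‖S‖²_{L²} = −2‖S‖²_{Ḣ¹} − (4/3)∫tr(S³) = −2‖S‖²_{Ḣ¹} − 4∫det S`;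
* **Prop 5.1** (`∂ₜE ≥ g₀E^{3/2}`, `E = ‖S‖²_{L²}`, `g₀ = (−3‖S⁰‖²_{Ḣ¹} − 4∫det S⁰)/‖S⁰‖³_{L²}`), via the
  monotone quantity `g = (−3‖S‖²_{Ḣ¹} − 4∫det S)/‖S‖³_{L²}`: "`∂ₜg = 6‖−ΔS + ⅔P_{st}(S²)‖²/E^{3/2} − …
  ≥ 0`";
* **Thm 5.3 = Thm 1.11** (finite-time blow-up): if `−3‖S⁰‖²_{Ḣ¹} − 4∫det S⁰ > 0` then
  `E(t) > E₀/(1 − r₀t)²`, `r₀ = (−3‖S⁰‖²_{Ḣ¹} − 4∫det S⁰)/(2‖S⁰‖²_{L²})`, "in particular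
  `T_max < 2‖S⁰‖²_{L²}/(−3‖S⁰‖²_{Ḣ¹} − 4∫det S⁰)`".

Setting of this file: the flat torus `T^d = UnitAddTorus d` (any finite nonempty `d`), CLASSICAL
solutions on a closed time interval, viscosity `ν ≥ 0` kept as a parameter (Miller: `ℝ³`, mild `H¹_{st}`
solutions, `ν = 1`). Following Miller's own dictionary `u = −2 div(−Δ)⁻¹S`, `S = ∇_{sym}u` (Prop 1.4,
Rem 3.5) the model is written for the velocity:

* `Torus.IsStrainModelSolutionOn I ν u` — `u` jointly smooth on `I × T^d`, divergence free, and
  `∂ₜu = νΔu − ⅔ z_{S²}` with `z_M = Torus.strainPotential M` (tree `TorusStrainProjection`: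
  `∇_{sym}z_M = P_{st}M`), `(S²)_{ab} = ∑_c S_{ac}S_{cb}`, `S_{ab} = ½((∂_b u)_a + (∂_a u)_b)`;
  `….timeDerivWithin_strain_eq` — then **`∂ₜS = νΔS − ⅔P_{st}(S²)` entrywise, verbatim (4.1)**.
* `….hasDerivWithinAt_strainNormSq` — **Prop 4.3**: `d/dt ∫∑S_{ij}² = −ν‖Δu‖²_{L²} − (4/3)∫∑S_{ij}S_{jk}S_{ki}`
  (`‖S‖²_{L²} = ∫∑S_{ij}²`; `‖S‖²_{Ḣ¹} = ½‖Δu‖²`, tree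
  `StrainProjectionCriterion.sum_integral_sum_partialDeriv_strain_sq_eq`; `∫tr S³ = ∫∑S_{ij}S_{jk}S_{ki}`,
  `= 3∫det S` on `T³`, tree `StrainPerturbativeBlowup.four_mul_integral_det_strain_eq`);
  `….two_mul_integral_sum_strain_mul_eq` (`2⟨S, ∂ₜS⟩ = …`, the printed computation).
* `….hasDerivWithinAt_strainFlux` — **`∂ₜf = 6‖∂ₜS‖²_{L²}`** for
  `f = −3ν‖S‖²_{Ḣ¹} − (4/3)∫tr S³ = −(3ν/2)‖Δu‖² − (4/3)∫∑S_{ij}S_{jk}S_{ki}` (the numerator of Miller's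
  `g`; `∂ₜS = −(−νΔS + ⅔P_{st}(S²))`); `….strainFlux_le` — `f(0) ≤ f(t)`.
* `….strainNormSq_deriv_ge` — **Prop 5.1** (for `f₀ = f(0) > 0`):
  `∂ₜE(t) ≥ (f₀/E₀^{3/2})·E(t)^{3/2}` (`E^{3/2} = E√E`).
* `….strainNormSq_ge_and_time_lt`, `….time_lt`, `….time_lt_torusEnstrophy` — **Thm 5.3 = Thm 1.11**:
  `1 − r₀t > 0`, `E(t) ≥ E₀/(1 − r₀t)²` on `[0, T]`, `r₀ = f₀/(2E₀)`, and `T < 2E₀/f₀ = 2ℰ(u₀)/f₀`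
  (`E = ‖S‖²_{L²} = ℰ(u) = ½‖∇u‖²`, tree `integral_strainNormSq_eq_torusEnstrophy`).

Generic kinematics proved on the way (any jointly smooth velocity): `timeDerivWithin_strain`
(`∂ₜS = ∇_{sym}∂ₜu`), `hasDerivWithinAt_integral_sum_strain_sq` (`d/dt‖S‖² = 2⟨S,∂ₜS⟩`),
`hasDerivWithinAt_half_integral_norm_sq_laplacian` (`d/dt ½‖Δu‖² = ⟨Δ∂ₜu, Δu⟩`),
`integral_inner_laplacian_laplacian_eq` (`⟨Δw, Δv⟩ = −2⟨∇_{sym}w, ∇_{sym}Δv⟩`, `div v = 0`),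
`hasDerivWithinAt_integral_trace_strain_cube` (`d/dt∫tr S³ = 3⟨∂ₜS, S²⟩`); and the real-variable core
`ode_flux_ge`, `ode_energy_pos`, `ode_ratio_monotoneOn`, `ode_deriv_ge`, `ode_riccati` (from
`∂ₜf ≥ 0`, `(∂ₜE)² ≤ (2/3)E∂ₜf`, `f ≤ ∂ₜE`, `f(0) > 0`: `f/E^{3/2}` non-decreasing, `∂ₜE ≥ g₀E^{3/2}`,
`E^{−1/2} + (g₀/2)t` non-increasing).

Proof architecture (the printed proofs, followed): Prop 4.3 — `2⟨∂ₜS, S⟩ = −2⟨−νΔS + ⅔P_{st}(S²), S⟩`,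
"we have used the fact that `S ∈ L²_{st}` to drop the projection `P_{st}`"
(tree `Torus.integral_sum_strainProjection_mul_symGrad_eq`), `⟨S², S⟩ = ∫tr S³`. Prop 5.1 —
`∂ₜf = 6ν⟨ΔS, ∂ₜS⟩ − 4⟨S², ∂ₜS⟩` and `νΔS = ∂ₜS + ⅔P_{st}(S²)` give `∂ₜf = 6‖∂ₜS‖² +
4(⟨P_{st}(S²), ∂ₜS⟩ − ⟨S², ∂ₜS⟩) = 6‖∂ₜS‖²` since `∂ₜS = ∇_{sym}∂ₜu` with `∂ₜu` divergence free
(this is Miller's `6‖−ΔS + ⅔P_{st}(S²)‖²`); then `∂ₜg ≥ 0` by Cauchy–Schwarz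
`(∂ₜE)² = 4⟨S, ∂ₜS⟩² ≤ 4‖S‖²‖∂ₜS‖²` and `f ≤ ∂ₜE`. Thm 5.3 — integrate `∂ₜE ≥ g₀E^{3/2}` as
`∂ₜ(E^{−1/2}) ≤ −g₀/2`.

SCOPE / READING NOTES (faithfulness). (1) The printed Prop 5.1 carries no sign hypothesis on `g₀`;
its proof bounds `−(3/2)f·∂ₜE` below by `−(3/2)(∂ₜE)²`, which requires `∂ₜE ≥ 0`, i.e. `f ≥ −‖S‖²_{Ḣ¹}`…
precisely `f·∂ₜE ≤ (∂ₜE)² ⟺ ∂ₜE·ν‖S‖²_{Ḣ¹} ≥ 0`; this holds whenever `f > 0` (then `∂ₜE ≥ f > 0`),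
in particular throughout `[0, T]` once `f(0) > 0` because `f` is non-decreasing — the case needed for
Thm 5.3 / Thm 1.11, which is what we type (hypothesis `f₀ > 0` in `….strainNormSq_deriv_ge`). For
`g₀ < 0` the printed inequality `∂ₜE ≥ g₀E^{3/2}` can fail for small decaying solutions
(`∂ₜE ≈ −2νλE < g₀E^{3/2}` once `E` is small); we do not type that case. (2) Conclusions are on a
closed interval `[0, T]` carrying a classical solution: `E(t) ≥ E₀/(1 − r₀t)²` (Miller: strict `>`
for `t > 0`) and `T < 2E₀/f₀` (Miller: `T_max <` the same bound; the arXiv displays of BOTH Thm 1.11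
and Thm 5.3, and the last line of the proof of Thm 5.3, print `‖S⁰‖²_{L²}` in place of `‖S⁰‖²_{Ḣ¹}`
inside that denominator, and the display of `r₀` prints `−4det(S⁰)` without the integral sign —
`T_max < 1/r₀ = 2‖S⁰‖²_{L²}/(−3‖S⁰‖²_{Ḣ¹} − 4∫det S⁰)` is meant and typed; referee remark F127.1 of the
pub-nsfunc cell). (3) The
determinant form `−3‖S⁰‖²_{Ḣ¹} − 4∫det S⁰` of `f₀` is the `T³` reading of our `−3ν‖S‖²_{Ḣ¹} −
(4/3)∫tr S³` (`det S = ⅓tr S³` for trace-free symmetric `3×3` matrices, Prop 1.9; tree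
`four_mul_integral_det_strain_eq`); we keep the trace form, valid in every dimension. (4) Not typed:
local existence / the maximal solution (Thm 4.1), small-data global existence (Thm 4.6), the model's
`λ₂⁺` criterion (Thm 4.8) and hence the `λ₂⁺` clause of Thm 1.11, the perturbative NS results
(§6; Thm 6.1 is the tree file `TorusNSStrainPerturbativeBlowup`).
These serve the functional-mining cell (pub-nsfunc): TAO-BARRIER.md §3 ("second printed filter": no
functional whose budget uses only the `‖S‖²_{L²}` identity and the constraint space separates
Navier–Stokes from this model) now has its model side as Lean theorems; the monotone quantity
`f/E^{3/2}` along the MODEL is recorded for the dictionary (it is NOT monotone along Navier–Stokes).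

## Mathlib / tree search

Tree (used): `Torus.strainPotential`, `Torus.strainProjection`, `Torus.isSmooth_strainPotential`,
`Torus.isSmooth_strainProjection`, `Torus.isDivFree_strainPotential` (via
`integral_sum_strainProjection_mul_symGrad_eq`), `StrainProjection.integral_sum_symGradScalar_mul_symGrad_eq`
(`FluidPDE/TorusStrainProjection`); `StrainProjectionCriterion.integral_sum_laplacianStrain_mul_symGrad_eq`
(`TorusNSStrainProjectionCriterion`); `integral_strainNormSq_eq_torusEnstrophy`
(`TorusStrainVorticityIsometry`); `Torus.integral_inner_laplacian_iterate_comm` (`TorusClassicalHnBalance`);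
`Torus.IsDivFree.laplacian_of_isSmooth` (`TorusClassicalH1Balance`); space–time calculus
`IsSmoothSpaceTimeOn.hasDerivWithinAt_integral`, `….hasDerivWithinAt_slice`, `….isSmooth_timeDerivWithin`,
`Torus.timeDerivWithin_partialDeriv_comm`, `Torus.timeDerivWithin_laplacian_comm`,
`Torus.timeDerivWithin_clm_comp/_add/_const_smul/_finset_sum` (`TorusCalculusProofs`,
`TorusInverseLaplacianCalculus`, `TorusSpaceTime`); `Torus.integral_sum_sum_mul_le_sqrt_mul_sqrt`
(Cauchy–Schwarz for matrix fields); Mathlib `monotoneOn_of_hasDerivWithinAt_nonneg`,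
`antitoneOn_of_hasDerivWithinAt_nonpos`, `HasDerivWithinAt.sqrt`, `HasDerivWithinAt.inv`. The cyclic
trace identity and the strain space–time smoothness helper are re-proved privately (their tree versions
in `TorusNSStrainPerturbativeBlowup` are private). Searched (`lean search`):
`self.?amplification|strainModel|StrainModel` — only citations of the paper (Prop 1.9, Thm 6.1 files);
no model equation in the tree before this file.

## References

* [Miller2023StrainModel] E. Miller, *Finite-time blowup for a Navier–Stokes model equation for the
  self-amplification of strain*, Anal. PDE 16 (2023) 997–1032 = arXiv:1910.05415: (1.19), Def 1.7,
  Prop 1.9, Thm 1.11, Rem 1.12, §4 (4.1), Prop 4.3 (with proof), §5 Prop 5.1 (with proof), Rem 5.2,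
  Thm 5.3 (held text paper:arxiv-1910.05415, chunks 5–6, 12–13, 17).
* [Miller2019] E. Miller, Arch. Ration. Mech. Anal. 235 (2020) 99–139: Def 2.2, Prop 2.3 (proof:
  `−2 div ∇_{sym}u = −Δu`), Prop 3.1 (`‖S‖² = ½‖∇u‖²`).
* [Miller2026StrainVorticity] E. Miller, Pure Appl. Anal. 8 (2026) 247–270: (1.24)–(1.25) (the
  `μ`-family of models sharing the enstrophy identity; `μ = ⅔` is this model).
-/

noncomputable section

open MeasureTheory Set Function Finset
open scoped InnerProductSpace

namespace Literature.Analysis.FluidPDE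

open Literature.Analysis.FunctionSpaces Literature.Analysis.FunctionSpaces.Torus
  StrainProjectionCriterion

variable {d : Type*} [Fintype d] [DecidableEq d]

/-- **Miller's strain self-amplification model equation**, classical solutions on a time set `I`
(Anal. PDE 16 (2023), eq. (1.19) = §4 (4.1): `∂ₜS − ΔS + ⅔P_{st}(S²) = 0`, an evolution equation on
the strain space `L²_{st}`; obtained from the Navier–Stokes strain equation
`∂ₜS − ΔS + P_{st}((u·∇)S + S² + ¼ω⊗ω) = 0` by "dropping `P_{st}((u·∇)S + ⅓S² + ¼ω⊗ω)`", Prop 1.5 /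
§4), written — as Miller does for data and solutions (`u = −2 div(−Δ)⁻¹S`, Prop 1.4, Rem 3.5) — for
the VELOCITY `u` whose strain `S = ∇_{sym}u`, `S_{ab} = ½((∂_b u)_a + (∂_a u)_b)`, solves the model:
`u : I × T^d → ℝ^d` is jointly smooth, divergence free, and

  `∂ₜu = νΔu − ⅔ z_{S²}`,  `z_M = Torus.strainPotential M` (so that `∇_{sym}z_M = P_{st}M`),

`(S²)_{ab} = ∑_c S_{ac}S_{cb}`; applying `∇_{sym}` gives exactly `∂ₜS = νΔS − ⅔P_{st}(S²)`
(`Torus.IsStrainModelSolutionOn.timeDerivWithin_strain_eq`). Viscosity `ν` is kept as a parameter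
(Miller: `ν = 1`); the time derivative is one-sided within `I` (`Torus.timeDerivWithin`).
[cite: Miller2023StrainModel, eq. (1.19) and §4 eq. (4.1) (the model), Prop 1.4 / Rem 3.5 (`u = −2 div(−Δ)⁻¹S`)] -/
def Torus.IsStrainModelSolutionOn (I : Set ℝ) (ν : ℝ)
    (u : ℝ → UnitAddTorus d → EuclideanSpace ℝ d) : Prop :=
  Torus.IsSmoothSpaceTimeOn I u ∧ (∀ t ∈ I, Torus.IsDivFree (u t)) ∧
    ∀ t ∈ I, ∀ x, Torus.timeDerivWithin I u t x =
      ν • Torus.laplacian (u t) x -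
        (2 / 3 : ℝ) • Torus.strainPotential (fun a b y =>
          ∑ c, ((Torus.partialDeriv c (u t) y a + Torus.partialDeriv a (u t) y c) / 2) *
            ((Torus.partialDeriv b (u t) y c + Torus.partialDeriv c (u t) y b) / 2)) x

namespace StrainModel

/-! ### §0 Helpers: smoothness, products, finite sums -/

omit [DecidableEq d] in
/-- Finite sums of smooth scalar functions are smooth. [folklore] -/
private theorem isSmooth_sum {ι : Type*} (s : Finset ι) {g : ι → UnitAddTorus d → ℝ}
    (hg : ∀ i ∈ s, Torus.IsSmooth (g i)) : Torus.IsSmooth (fun x => ∑ i ∈ s, g i x) := by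
  have hl : Torus.lift (fun x => ∑ i ∈ s, g i x) = fun z => ∑ i ∈ s, Torus.lift (g i) z := rfl
  unfold Torus.IsSmooth
  rw [hl]
  exact ContDiff.sum fun i hi => hg i hi

omit [DecidableEq d] in
/-- Products of smooth scalar functions are smooth (pointwise form). [folklore] -/
private theorem smooth_mul {a b : UnitAddTorus d → ℝ} (ha : Torus.IsSmooth a) (hb : Torus.IsSmooth b) :
    Torus.IsSmooth (fun y => a y * b y) := ha.mul hb

omit [DecidableEq d] in
/-- Squares of smooth scalar functions are smooth (pointwise form). [folklore] -/
private theorem smooth_sq {a : UnitAddTorus d → ℝ} (ha : Torus.IsSmooth a) :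
    Torus.IsSmooth (fun y => a y ^ 2) := ha.pow 2

omit [DecidableEq d] in
/-- Product rule for one-sided time derivatives of scalar space–time fields. [folklore] -/
private theorem timeDerivWithin_mul {S : Set ℝ} {A B : ℝ → UnitAddTorus d → ℝ}
    (hA : Torus.IsSmoothSpaceTimeOn S A) (hB : Torus.IsSmoothSpaceTimeOn S B) (hS : UniqueDiffOn ℝ S)
    {t : ℝ} (ht : t ∈ S) (x : UnitAddTorus d) :
    Torus.timeDerivWithin S (fun s y => A s y * B s y) t x =
      Torus.timeDerivWithin S A t x * B t x + A t x * Torus.timeDerivWithin S B t x :=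
  ((hA.hasDerivWithinAt_slice ht x).fun_mul (hB.hasDerivWithinAt_slice ht x)).derivWithin (hS t ht)

omit [DecidableEq d] in
/-- The cyclic symmetrisation behind `d/dt tr(S³) = 3 tr(S² Ṡ)` (symmetric `S`). [folklore] -/
private theorem sum_cyclic_eq_three_mul (X S : d → d → ℝ) (hS : ∀ a b, S a b = S b a) :
    ∑ a, ∑ b, ∑ c, (X a b * S b c * S c a + S a b * X b c * S c a + S a b * S b c * X c a) =
      3 * ∑ a, ∑ b, X a b * ∑ c, S a c * S c b := by
  have h1 : ∑ a, ∑ b, ∑ c, X a b * S b c * S c a = ∑ a, ∑ b, X a b * ∑ c, S a c * S c b := by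
    refine Finset.sum_congr rfl fun a _ => Finset.sum_congr rfl fun b _ => ?_
    rw [Finset.mul_sum]
    exact Finset.sum_congr rfl fun c _ => by rw [hS b c, hS c a]; ring
  have h2 : ∑ a, ∑ b, ∑ c, S a b * X b c * S c a = ∑ a, ∑ b, X a b * ∑ c, S a c * S c b := by
    have e : ∑ a, ∑ b, ∑ c, S a b * X b c * S c a = ∑ b, ∑ c, ∑ a, S a b * X b c * S c a := by
      rw [Finset.sum_comm]
      exact Finset.sum_congr rfl fun b _ => Finset.sum_comm
    rw [e]
    refine Finset.sum_congr rfl fun b _ => Finset.sum_congr rfl fun c _ => ?_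
    rw [Finset.mul_sum]
    exact Finset.sum_congr rfl fun a _ => by rw [hS a b, hS c a]; ring
  have h3 : ∑ a, ∑ b, ∑ c, S a b * S b c * X c a = ∑ a, ∑ b, X a b * ∑ c, S a c * S c b := by
    have e : ∑ a, ∑ b, ∑ c, S a b * S b c * X c a = ∑ c, ∑ a, ∑ b, S a b * S b c * X c a := by
      have e1 : ∑ a, ∑ b, ∑ c, S a b * S b c * X c a = ∑ a, ∑ c, ∑ b, S a b * S b c * X c a :=
        Finset.sum_congr rfl fun a _ => Finset.sum_comm
      rw [e1, Finset.sum_comm]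
    rw [e]
    refine Finset.sum_congr rfl fun c _ => Finset.sum_congr rfl fun a _ => ?_
    rw [Finset.mul_sum]
    exact Finset.sum_congr rfl fun b _ => by rw [hS c b, hS b a]; ring
  simp only [Finset.sum_add_distrib]
  rw [h1, h2, h3]
  ring

/-! ### §1 Kinematics of a jointly smooth velocity: the strain entries and their time derivative -/

variable {a b : ℝ} {u : ℝ → UnitAddTorus d → EuclideanSpace ℝ d}

/-- The strain entries `(t, x) ↦ S_{ab}(t, x) = ½((∂_b u)_a + (∂_a u)_b)` of a jointly smooth
velocity are jointly smooth. [folklore] -/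
private theorem isSmoothSpaceTimeOn_strain (hu : Torus.IsSmoothSpaceTimeOn (Icc a b) u) (hab : a < b)
    (i j : d) :
    Torus.IsSmoothSpaceTimeOn (Icc a b)
      (fun s y => (Torus.partialDeriv j (u s) y i + Torus.partialDeriv i (u s) y j) / 2) := by
  have hS : UniqueDiffOn ℝ (Icc a b) := uniqueDiffOn_Icc hab
  have hA : Torus.IsSmoothSpaceTimeOn (Icc a b) (fun s y => Torus.partialDeriv j (u s) y i) :=
    (hu.partialDeriv hS j).apply i
  have hB : Torus.IsSmoothSpaceTimeOn (Icc a b) (fun s y => Torus.partialDeriv i (u s) y j) :=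
    (hu.partialDeriv hS i).apply j
  exact ContDiffOn.div_const (ContDiffOn.add hA hB) 2

/-- A strain slice `S_{ab}(t, ·)` is smooth. [folklore] -/
private theorem isSmooth_strain {v : UnitAddTorus d → EuclideanSpace ℝ d} (hv : Torus.IsSmooth v) (i j : d) :
    Torus.IsSmooth (fun y => (Torus.partialDeriv j v y i + Torus.partialDeriv i v y j) / 2) :=
  (((hv.partialDeriv j).apply i).add ((hv.partialDeriv i).apply j)).div_const 2

/-- **`∂ₜS = ∇_{sym}(∂ₜu)`**: the time derivative of the strain entries of a jointly smooth
velocity on `[a, b] × T^d` is the strain of the (one-sided) time derivative: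
`∂ₜS_{ij} = ½((∂_j ∂ₜu)_i + (∂_i ∂ₜu)_j)` (`∂ₜ∂_j = ∂_j∂ₜ` for jointly smooth fields) — the
kinematic step behind "taking the derivative in time of the `L²` norm, we plug into the strain
self-amplification model equation" (Miller, Anal. PDE 16 (2023), proof of Prop 4.3).
[cite: Miller2023StrainModel, Prop 4.3 (proof)] -/
theorem timeDerivWithin_strain (hu : Torus.IsSmoothSpaceTimeOn (Icc a b) u) (hab : a < b)
    {t : ℝ} (ht : t ∈ Icc a b) (i j : d) (x : UnitAddTorus d) :
    Torus.timeDerivWithin (Icc a b)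
        (fun s y => (Torus.partialDeriv j (u s) y i + Torus.partialDeriv i (u s) y j) / 2) t x =
      (Torus.partialDeriv j (Torus.timeDerivWithin (Icc a b) u t) x i +
        Torus.partialDeriv i (Torus.timeDerivWithin (Icc a b) u t) x j) / 2 := by
  have hS : UniqueDiffOn ℝ (Icc a b) := uniqueDiffOn_Icc hab
  have hA : ∀ i j, Torus.IsSmoothSpaceTimeOn (Icc a b) (fun s y => Torus.partialDeriv j (u s) y i) :=
    fun i j => (hu.partialDeriv hS j).apply i
  -- components of `∂ₜ∂_j u`
  have hcomp : ∀ i j, Torus.timeDerivWithin (Icc a b) (fun s y => Torus.partialDeriv j (u s) y i) t x =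
      Torus.partialDeriv j (Torus.timeDerivWithin (Icc a b) u t) x i := by
    intro i j
    have h1 := Torus.timeDerivWithin_clm_comp (hu.partialDeriv hS j) hS (EuclideanSpace.proj i) ht x
    simp only [PiLp.proj_apply] at h1
    rw [h1, Torus.timeDerivWithin_partialDeriv_comm hab hu ht j x]
  have hsum : Torus.IsSmoothSpaceTimeOn (Icc a b)
      (fun s y => Torus.partialDeriv j (u s) y i + Torus.partialDeriv i (u s) y j) := (hA i j).add (hA j i)
  have e1 : (fun s y => (Torus.partialDeriv j (u s) y i + Torus.partialDeriv i (u s) y j) / 2) =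
      fun s y => (2⁻¹ : ℝ) • (Torus.partialDeriv j (u s) y i + Torus.partialDeriv i (u s) y j) := by
    funext s y; rw [smul_eq_mul]; ring
  rw [e1, Torus.timeDerivWithin_const_smul hsum hS _ ht x, Torus.timeDerivWithin_add (hA i j) (hA j i) hS ht x,
    hcomp i j, hcomp j i, smul_eq_mul]
  ring

/-- **The divergence of `∂ₜu` vanishes** when `u(s)` is divergence free for all `s ∈ [a, b]`
(`div ∂ₜu = ∂ₜ div u = 0`). [folklore] -/
private theorem isDivFree_timeDerivWithin (hu : Torus.IsSmoothSpaceTimeOn (Icc a b) u) (hab : a < b)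
    (hdiv : ∀ s ∈ Icc a b, Torus.IsDivFree (u s)) {t : ℝ} (ht : t ∈ Icc a b) :
    Torus.IsDivFree (Torus.timeDerivWithin (Icc a b) u t) := by
  have hS : UniqueDiffOn ℝ (Icc a b) := uniqueDiffOn_Icc hab
  intro x
  have hw1 : Torus.IsContDiff 1 (Torus.timeDerivWithin (Icc a b) u t) :=
    (hu.isSmooth_timeDerivWithin hS ht).isContDiff (by simp)
  rw [Torus.divergence_eq_sum_partialDeriv_apply hw1]
  have hA : ∀ i, Torus.IsSmoothSpaceTimeOn (Icc a b) (fun s y => Torus.partialDeriv i (u s) y i) :=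
    fun i => (hu.partialDeriv hS i).apply i
  have hcomp : ∀ i, Torus.partialDeriv i (Torus.timeDerivWithin (Icc a b) u t) x i =
      Torus.timeDerivWithin (Icc a b) (fun s y => Torus.partialDeriv i (u s) y i) t x := by
    intro i
    have h1 := Torus.timeDerivWithin_clm_comp (hu.partialDeriv hS i) hS (EuclideanSpace.proj i) ht x
    simp only [PiLp.proj_apply] at h1
    rw [h1, Torus.timeDerivWithin_partialDeriv_comm hab hu ht i x]
  simp_rw [hcomp]
  rw [← Torus.timeDerivWithin_finset_sum _ (fun i _ => hA i) hS ht x]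
  -- `s ↦ div u(s) (x)` vanishes on `[a, b]`
  unfold Torus.timeDerivWithin
  have hzero : ∀ s ∈ Icc a b, (∑ i, Torus.partialDeriv i (u s) x i) = 0 := by
    intro s hs
    have h := hdiv s hs x
    rw [Torus.divergence_eq_sum_partialDeriv_apply ((hu.isSmooth_slice hs).isContDiff (by simp))] at h
    exact h
  rw [derivWithin_congr (f := fun _ => (0 : ℝ)) (fun s hs => hzero s hs) (hzero t ht)]
  simp

/-! ### §2 Generic balances along a jointly smooth velocity -/

/-- **`d/dt ‖S‖²_{L²} = 2⟨S, ∂ₜS⟩`** for the strain of a jointly smooth velocity on `[a, b] × T^d`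
(differentiation under the integral sign; the first line of Miller's proof of Prop 4.3,
`∂ₜ‖S(·,t)‖²_{L²} = 2⟨∂ₜS, S⟩`). [cite: Miller2023StrainModel, Prop 4.3 (proof, first display)] -/
theorem hasDerivWithinAt_integral_sum_strain_sq (hu : Torus.IsSmoothSpaceTimeOn (Icc a b) u)
    (hab : a < b) {t : ℝ} (ht : t ∈ Icc a b) :
    HasDerivWithinAt
      (fun s => ∫ x, ∑ i, ∑ j, ((Torus.partialDeriv j (u s) x i + Torus.partialDeriv i (u s) x j) / 2) ^ 2)
      (2 * ∫ x, ∑ i, ∑ j, ((Torus.partialDeriv j (u t) x i + Torus.partialDeriv i (u t) x j) / 2) *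
        ((Torus.partialDeriv j (Torus.timeDerivWithin (Icc a b) u t) x i +
          Torus.partialDeriv i (Torus.timeDerivWithin (Icc a b) u t) x j) / 2))
      (Icc a b) t := by
  have hS : UniqueDiffOn ℝ (Icc a b) := uniqueDiffOn_Icc hab
  set Sf : d → d → ℝ → UnitAddTorus d → ℝ := fun i j s y =>
    (Torus.partialDeriv j (u s) y i + Torus.partialDeriv i (u s) y j) / 2 with hSf
  have hSfs : ∀ i j, Torus.IsSmoothSpaceTimeOn (Icc a b) (Sf i j) := fun i j =>
    isSmoothSpaceTimeOn_strain hu hab i j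
  set φ : ℝ → UnitAddTorus d → ℝ := fun s y => ∑ i, ∑ j, Sf i j s y ^ 2 with hφ
  have hsq : ∀ i j, Torus.IsSmoothSpaceTimeOn (Icc a b) (fun s y => Sf i j s y ^ 2) := by
    intro i j
    have e : (fun s y => Sf i j s y ^ 2) = fun s y => Sf i j s y * Sf i j s y := by funext s y; ring
    rw [e]; exact (hSfs i j).mul (hSfs i j)
  have hφs : Torus.IsSmoothSpaceTimeOn (Icc a b) φ :=
    Torus.IsSmoothSpaceTimeOn.sum fun i _ => Torus.IsSmoothSpaceTimeOn.sum fun j _ => hsq i j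
  have hD := hφs.hasDerivWithinAt_integral (convex_Icc a b) ht
  have hfun : (fun s => ∫ x, ∑ i, ∑ j,
      ((Torus.partialDeriv j (u s) x i + Torus.partialDeriv i (u s) x j) / 2) ^ 2) = fun s => ∫ x, φ s x := by
    funext s; rfl
  rw [hfun]
  refine hD.congr_deriv ?_
  have hderφ : ∀ y, Torus.timeDerivWithin (Icc a b) φ t y =
      2 * ∑ i, ∑ j, Sf i j t y * Torus.timeDerivWithin (Icc a b) (Sf i j) t y := by
    intro y
    simp only [hφ]
    rw [Torus.timeDerivWithin_finset_sum _ (fun i _ => Torus.IsSmoothSpaceTimeOn.sum fun j _ => hsq i j) hS ht]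
    rw [Finset.mul_sum]
    refine Finset.sum_congr rfl fun i _ => ?_
    rw [Torus.timeDerivWithin_finset_sum _ (fun j _ => hsq i j) hS ht]
    rw [Finset.mul_sum]
    refine Finset.sum_congr rfl fun j _ => ?_
    have e : (fun s y => Sf i j s y ^ 2) = fun s y => Sf i j s y * Sf i j s y := by funext s y; ring
    rw [e, timeDerivWithin_mul (hSfs i j) (hSfs i j) hS ht]
    ring
  rw [← MeasureTheory.integral_const_mul]
  refine integral_congr_ae (ae_of_all _ fun y => ?_)
  rw [hderφ y]
  congr 1
  refine Finset.sum_congr rfl fun i _ => Finset.sum_congr rfl fun j _ => ?_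
  simp only [hSf]
  rw [timeDerivWithin_strain hu hab ht i j y]

/-- **`d/dt ½‖Δu‖²_{L²} = ∫⟨Δ∂ₜu, Δu⟩`** for a jointly smooth velocity on `[a, b] × T^d`
(differentiation under the integral sign and `∂ₜΔ = Δ∂ₜ`; the generic part of the tree's
`H²` balance; with `‖S‖²_{Ḣ¹} = ½‖Δu‖²` this is the `∂ₜ‖S‖²_{Ḣ¹}` entering "differentiating `g`" in
Miller's proof of Prop 5.1). [cite: Miller2023StrainModel, Prop 5.1 (proof, `∂ₜg`)] -/
theorem hasDerivWithinAt_half_integral_norm_sq_laplacian (hu : Torus.IsSmoothSpaceTimeOn (Icc a b) u)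
    (hab : a < b) {t : ℝ} (ht : t ∈ Icc a b) :
    HasDerivWithinAt (fun s => 2⁻¹ * ∫ x, ‖Torus.laplacian (u s) x‖ ^ 2)
      (∫ x, ⟪Torus.laplacian (Torus.timeDerivWithin (Icc a b) u t) x, Torus.laplacian (u t) x⟫_ℝ)
      (Icc a b) t := by
  have hS : UniqueDiffOn ℝ (Icc a b) := uniqueDiffOn_Icc hab
  have hWst : Torus.IsSmoothSpaceTimeOn (Icc a b) (fun s => Torus.laplacian (u s)) := hu.laplacian hS
  have hφ : Torus.IsSmoothSpaceTimeOn (Icc a b) (fun s x => ‖Torus.laplacian (u s) x‖ ^ 2) :=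
    hWst.norm_sq ℝ
  have hE := (hφ.hasDerivWithinAt_integral (convex_Icc a b) ht).const_mul 2⁻¹
  have htd : ∀ x, Torus.timeDerivWithin (Icc a b) (fun s x => ‖Torus.laplacian (u s) x‖ ^ 2) t x =
      2 * ⟪Torus.laplacian (Torus.timeDerivWithin (Icc a b) u t) x, Torus.laplacian (u t) x⟫_ℝ := by
    intro x
    have h1 := ((hWst.hasDerivWithinAt_slice ht x).norm_sq).derivWithin (hS t ht)
    rw [Torus.timeDerivWithin, h1, ← Torus.timeDerivWithin_laplacian_comm hab hu ht x, real_inner_comm]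
  have hE' : 2⁻¹ * ∫ x, Torus.timeDerivWithin (Icc a b) (fun s x => ‖Torus.laplacian (u s) x‖ ^ 2) t x =
      ∫ x, ⟪Torus.laplacian (Torus.timeDerivWithin (Icc a b) u t) x, Torus.laplacian (u t) x⟫_ℝ := by
    simp_rw [htd, MeasureTheory.integral_const_mul]
    ring
  rw [hE'] at hE
  exact hE

/-- **`⟨Δw, Δv⟩ = −2⟨∇_{sym}w, ∇_{sym}Δv⟩`** for a smooth field `w` and a smooth divergence-free
`v` on `T^d` (Green twice; Miller's `−2 div ∇_{sym}u = −Δu` for divergence-free fields,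
ARMA 235 (2020), proof of Prop 2.3, applied to `Δv`). [cite: Miller2019, Prop 2.3 (proof)] -/
theorem integral_inner_laplacian_laplacian_eq {w v : UnitAddTorus d → EuclideanSpace ℝ d}
    (hw : Torus.IsSmooth w) (hv : Torus.IsSmooth v) (hdiv : Torus.IsDivFree v) :
    ∫ x, ⟪Torus.laplacian w x, Torus.laplacian v x⟫_ℝ =
      -(2 * ∫ x, ∑ i, ∑ j, ((Torus.partialDeriv j w x i + Torus.partialDeriv i w x j) / 2) *
        ((Torus.partialDeriv j (Torus.laplacian v) x i +
          Torus.partialDeriv i (Torus.laplacian v) x j) / 2)) := by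
  have hΔv : Torus.IsSmooth (Torus.laplacian v) := hv.laplacian
  have hdivΔ : Torus.IsDivFree (Torus.laplacian v) := Torus.IsDivFree.laplacian_of_isSmooth hv hdiv
  have hw1 : Torus.IsContDiff 1 w := hw.isContDiff (by simp)
  -- Green: `∫⟨Δw, Δv⟩ = ∫⟨w, Δ²v⟩`
  have h1 : ∫ x, ⟪Torus.laplacian w x, Torus.laplacian v x⟫_ℝ =
      ∫ x, ⟪w x, Torus.laplacian (Torus.laplacian v) x⟫_ℝ :=
    Torus.integral_inner_laplacian_iterate_comm 1 hw hΔv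
  -- the tree identity `⟨∇_{sym}z, ∇_{sym}U⟩ = −½∑_b ∫ z_b (ΔU)_b` with `z_b = w_b`, `U = Δv`
  have h2 := StrainProjection.integral_sum_symGradScalar_mul_symGrad_eq
    (z := fun b y => w y b) (fun b => hw.apply b) hΔv hdivΔ
  have h3 : ∀ x a b, Torus.partialDeriv a (fun y => w y b) x = Torus.partialDeriv a w x b :=
    fun x a b => Torus.partialDeriv_apply_coord hw1 a x b
  simp_rw [h3] at h2
  have h4 : ∫ x, ∑ i, ∑ j, ((Torus.partialDeriv j w x i + Torus.partialDeriv i w x j) / 2) *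
      ((Torus.partialDeriv j (Torus.laplacian v) x i +
        Torus.partialDeriv i (Torus.laplacian v) x j) / 2) =
      ∫ x, ∑ a, ∑ b, (Torus.partialDeriv a w x b + Torus.partialDeriv b w x a) / 2 *
        ((Torus.partialDeriv b (Torus.laplacian v) x a +
          Torus.partialDeriv a (Torus.laplacian v) x b) / 2) :=
    integral_congr_ae (ae_of_all _ fun x =>
      Finset.sum_congr rfl fun a _ => Finset.sum_congr rfl fun b _ => by ring)
  rw [h4, h2, h1]
  have h5 : ∀ x, ⟪w x, Torus.laplacian (Torus.laplacian v) x⟫_ℝ =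
      ∑ b, w x b * Torus.laplacian (Torus.laplacian v) x b := by
    intro x
    rw [PiLp.inner_apply]
    exact Finset.sum_congr rfl fun b _ => by simp [mul_comm]
  simp_rw [h5]
  rw [integral_finsetSum _ fun b _ => (smooth_mul (hw.apply b) (hΔv.laplacian.apply b)).integrable]
  ring

/-- **`d/dt ∫tr(S³) = 3⟨S², ∂ₜS⟩`** for the strain of a jointly smooth velocity on `[a, b] × T^d`
(differentiation under the integral sign, product rule and the cyclic symmetry of the trace;
`∂ₜS = ∇_{sym}∂ₜu`) — the `∂ₜ∫tr(S³)` entering "differentiating `g`" in Miller's proof of Prop 5.1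
(there through `∫det S = ⅓∫tr S³`). [cite: Miller2023StrainModel, Prop 5.1 (proof, `∂ₜg`)] -/
theorem hasDerivWithinAt_integral_trace_strain_cube (hu : Torus.IsSmoothSpaceTimeOn (Icc a b) u)
    (hab : a < b) {t : ℝ} (ht : t ∈ Icc a b) :
    HasDerivWithinAt
      (fun s => ∫ x, ∑ i, ∑ j, ∑ k,
        ((Torus.partialDeriv j (u s) x i + Torus.partialDeriv i (u s) x j) / 2) *
        ((Torus.partialDeriv k (u s) x j + Torus.partialDeriv j (u s) x k) / 2) *
        ((Torus.partialDeriv i (u s) x k + Torus.partialDeriv k (u s) x i) / 2))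
      (3 * ∫ x, ∑ i, ∑ j,
        ((Torus.partialDeriv j (Torus.timeDerivWithin (Icc a b) u t) x i +
          Torus.partialDeriv i (Torus.timeDerivWithin (Icc a b) u t) x j) / 2) *
        ∑ k, ((Torus.partialDeriv k (u t) x i + Torus.partialDeriv i (u t) x k) / 2) *
          ((Torus.partialDeriv j (u t) x k + Torus.partialDeriv k (u t) x j) / 2))
      (Icc a b) t := by
  have hS : UniqueDiffOn ℝ (Icc a b) := uniqueDiffOn_Icc hab
  set Sf : d → d → ℝ → UnitAddTorus d → ℝ := fun i j s y =>
    (Torus.partialDeriv j (u s) y i + Torus.partialDeriv i (u s) y j) / 2 with hSf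
  have hSfs : ∀ i j, Torus.IsSmoothSpaceTimeOn (Icc a b) (Sf i j) := fun i j =>
    isSmoothSpaceTimeOn_strain hu hab i j
  have hsym : ∀ i j s y, Sf i j s y = Sf j i s y := by
    intro i j s y; simp only [hSf]; ring
  set φ : ℝ → UnitAddTorus d → ℝ := fun s y => ∑ i, ∑ j, ∑ k, Sf i j s y * Sf j k s y * Sf k i s y with hφ
  have hφs : Torus.IsSmoothSpaceTimeOn (Icc a b) φ :=
    Torus.IsSmoothSpaceTimeOn.sum fun i _ => Torus.IsSmoothSpaceTimeOn.sum fun j _ =>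
      Torus.IsSmoothSpaceTimeOn.sum fun k _ => ((hSfs i j).mul (hSfs j k)).mul (hSfs k i)
  have hD := hφs.hasDerivWithinAt_integral (convex_Icc a b) ht
  have hfun : (fun s => ∫ x, ∑ i, ∑ j, ∑ k,
      ((Torus.partialDeriv j (u s) x i + Torus.partialDeriv i (u s) x j) / 2) *
      ((Torus.partialDeriv k (u s) x j + Torus.partialDeriv j (u s) x k) / 2) *
      ((Torus.partialDeriv i (u s) x k + Torus.partialDeriv k (u s) x i) / 2)) = fun s => ∫ x, φ s x := by
    funext s; rfl
  rw [hfun]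
  refine hD.congr_deriv ?_
  set Sd : d → d → UnitAddTorus d → ℝ := fun i j y => Torus.timeDerivWithin (Icc a b) (Sf i j) t y with hSd
  have hderφ : ∀ y, Torus.timeDerivWithin (Icc a b) φ t y =
      3 * ∑ i, ∑ j, Sd i j y * ∑ k, Sf i k t y * Sf k j t y := by
    intro y
    have e1 : Torus.timeDerivWithin (Icc a b) φ t y =
        ∑ i, ∑ j, ∑ k, Torus.timeDerivWithin (Icc a b)
          (fun s z => Sf i j s z * Sf j k s z * Sf k i s z) t y := by
      simp only [hφ]
      rw [Torus.timeDerivWithin_finset_sum _ (fun i _ => Torus.IsSmoothSpaceTimeOn.sum fun j _ =>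
        Torus.IsSmoothSpaceTimeOn.sum fun k _ => ((hSfs i j).mul (hSfs j k)).mul (hSfs k i)) hS ht]
      refine Finset.sum_congr rfl fun i _ => ?_
      rw [Torus.timeDerivWithin_finset_sum _ (fun j _ =>
        Torus.IsSmoothSpaceTimeOn.sum fun k _ => ((hSfs i j).mul (hSfs j k)).mul (hSfs k i)) hS ht]
      refine Finset.sum_congr rfl fun j _ => ?_
      rw [Torus.timeDerivWithin_finset_sum _ (fun k _ => ((hSfs i j).mul (hSfs j k)).mul (hSfs k i)) hS ht]
    rw [e1]
    have e2 : ∀ i j k, Torus.timeDerivWithin (Icc a b)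
        (fun s z => Sf i j s z * Sf j k s z * Sf k i s z) t y =
        Sd i j y * Sf j k t y * Sf k i t y + Sf i j t y * Sd j k y * Sf k i t y +
          Sf i j t y * Sf j k t y * Sd k i y := by
      intro i j k
      rw [timeDerivWithin_mul ((hSfs i j).mul (hSfs j k)) (hSfs k i) hS ht,
        timeDerivWithin_mul (hSfs i j) (hSfs j k) hS ht]
      simp only [hSd]
      ring
    simp only [e2]
    exact sum_cyclic_eq_three_mul (fun i j => Sd i j y) (fun i j => Sf i j t y) fun i j => hsym i j t y
  rw [← MeasureTheory.integral_const_mul]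
  refine integral_congr_ae (ae_of_all _ fun y => ?_)
  rw [hderφ y]
  congr 1
  refine Finset.sum_congr rfl fun i _ => Finset.sum_congr rfl fun j _ => ?_
  simp only [hSd, hSf]
  rw [timeDerivWithin_strain hu hab ht i j y]

/-! ### §3 The model: the strain equation and the enstrophy identity (Prop 4.3) -/

variable {ν : ℝ}

/-- The velocity of a model solution is jointly smooth. [cite: Miller2023StrainModel, §4 eq. (4.1)] -/
theorem _root_.Literature.Analysis.FluidPDE.Torus.IsStrainModelSolutionOn.smooth {I : Set ℝ}
    (h : Torus.IsStrainModelSolutionOn I ν u) : Torus.IsSmoothSpaceTimeOn I u := h.1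

/-- The velocity of a model solution is divergence free. [cite: Miller2023StrainModel, §4 eq. (4.1)] -/
theorem _root_.Literature.Analysis.FluidPDE.Torus.IsStrainModelSolutionOn.divFree {I : Set ℝ}
    (h : Torus.IsStrainModelSolutionOn I ν u) {t : ℝ} (ht : t ∈ I) : Torus.IsDivFree (u t) :=
  h.2.1 t ht

/-- The velocity equation of a model solution: `∂ₜu = νΔu − ⅔ z_{S²}`.
[cite: Miller2023StrainModel, §4 eq. (4.1) and Prop 1.4] -/
theorem _root_.Literature.Analysis.FluidPDE.Torus.IsStrainModelSolutionOn.timeDerivWithin_eq {I : Set ℝ}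
    (h : Torus.IsStrainModelSolutionOn I ν u) {t : ℝ} (ht : t ∈ I) (x : UnitAddTorus d) :
    Torus.timeDerivWithin I u t x =
      ν • Torus.laplacian (u t) x -
        (2 / 3 : ℝ) • Torus.strainPotential (fun a b y =>
          ∑ c, ((Torus.partialDeriv c (u t) y a + Torus.partialDeriv a (u t) y c) / 2) *
            ((Torus.partialDeriv b (u t) y c + Torus.partialDeriv c (u t) y b) / 2)) x :=
  h.2.2 t ht x

/-- The squared strain `(S²)_{ab} = ∑_c S_{ac}S_{cb}` of a smooth field is a smooth matrix field.
[folklore] -/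
private theorem isSmooth_strainSq {v : UnitAddTorus d → EuclideanSpace ℝ d} (hv : Torus.IsSmooth v) (a b : d) :
    Torus.IsSmooth (fun y => ∑ c, ((Torus.partialDeriv c v y a + Torus.partialDeriv a v y c) / 2) *
      ((Torus.partialDeriv b v y c + Torus.partialDeriv c v y b) / 2)) :=
  isSmooth_sum _ fun c _ => smooth_mul (isSmooth_strain hv a c) (isSmooth_strain hv c b)

/-- **The strain of `∂ₜu` along the model**: for a model solution on `[a, b] × T^d`,
`½((∂_j∂ₜu)_i + (∂_i∂ₜu)_j) = ν(ΔS)_{ij} − ⅔(P_{st}(S²))_{ij}`, `(ΔS)_{ij} = ½((∂_jΔu)_i + (∂_iΔu)_j)`.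
[cite: Miller2023StrainModel, §4 eq. (4.1)] -/
theorem _root_.Literature.Analysis.FluidPDE.Torus.IsStrainModelSolutionOn.symGrad_timeDerivWithin_eq
    [Nonempty d] (h : Torus.IsStrainModelSolutionOn (Icc a b) ν u) {t : ℝ}
    (ht : t ∈ Icc a b) (i j : d) (x : UnitAddTorus d) :
    (Torus.partialDeriv j (Torus.timeDerivWithin (Icc a b) u t) x i +
        Torus.partialDeriv i (Torus.timeDerivWithin (Icc a b) u t) x j) / 2 =
      ν * ((Torus.partialDeriv j (Torus.laplacian (u t)) x i +
          Torus.partialDeriv i (Torus.laplacian (u t)) x j) / 2) -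
        (2 / 3 : ℝ) * Torus.strainProjection (fun a b y =>
          ∑ c, ((Torus.partialDeriv c (u t) y a + Torus.partialDeriv a (u t) y c) / 2) *
            ((Torus.partialDeriv b (u t) y c + Torus.partialDeriv c (u t) y b) / 2)) i j x := by
  have hut : Torus.IsSmooth (u t) := h.smooth.isSmooth_slice ht
  set M : d → d → UnitAddTorus d → ℝ := fun a b y =>
    ∑ c, ((Torus.partialDeriv c (u t) y a + Torus.partialDeriv a (u t) y c) / 2) *
      ((Torus.partialDeriv b (u t) y c + Torus.partialDeriv c (u t) y b) / 2) with hM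
  have hMs : ∀ a b, Torus.IsSmooth (M a b) := fun a b => isSmooth_strainSq hut a b
  have hZ : Torus.IsSmooth (Torus.strainPotential M) := Torus.isSmooth_strainPotential hMs
  have hΔ : Torus.IsSmooth (Torus.laplacian (u t)) := hut.laplacian
  have hw : Torus.timeDerivWithin (Icc a b) u t =
      ν • Torus.laplacian (u t) + (-(2 / 3 : ℝ)) • Torus.strainPotential M := by
    funext y
    rw [h.timeDerivWithin_eq ht y, Pi.add_apply, Pi.smul_apply, Pi.smul_apply, neg_smul, sub_eq_add_neg]
  have hd : ∀ j, Torus.partialDeriv j (Torus.timeDerivWithin (Icc a b) u t) =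
      ν • Torus.partialDeriv j (Torus.laplacian (u t)) +
        (-(2 / 3 : ℝ)) • Torus.partialDeriv j (Torus.strainPotential M) := by
    intro j
    rw [hw, Torus.partialDeriv_add ((hΔ.smul ν).isContDiff (by simp)) ((hZ.smul _).isContDiff (by simp)),
      Torus.partialDeriv_const_smul (hΔ.isContDiff (by simp)),
      Torus.partialDeriv_const_smul (hZ.isContDiff (by simp))]
  have hd' : ∀ j i, Torus.partialDeriv j (Torus.timeDerivWithin (Icc a b) u t) x i =
      ν * Torus.partialDeriv j (Torus.laplacian (u t)) x i +
        (-(2 / 3 : ℝ)) * Torus.partialDeriv j (Torus.strainPotential M) x i := by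
    intro j i
    rw [hd j]
    simp only [Pi.add_apply, Pi.smul_apply, PiLp.add_apply, PiLp.smul_apply, smul_eq_mul]
  rw [hd' j i, hd' i j, Torus.strainProjection]
  ring

/-- **Miller's model equation for the strain, verbatim** (Anal. PDE 16 (2023), (1.19)/(4.1)):
along a model solution on `[a, b] × T^d`, `∂ₜS = νΔS − ⅔P_{st}(S²)` entrywise,
`∂ₜS_{ij} = ν·½((∂_jΔu)_i + (∂_iΔu)_j) − ⅔(P_{st}(S²))_{ij}` (one-sided time derivative within `[a, b]`).
[cite: Miller2023StrainModel, eq. (1.19) and §4 eq. (4.1)] -/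
theorem _root_.Literature.Analysis.FluidPDE.Torus.IsStrainModelSolutionOn.timeDerivWithin_strain_eq
    [Nonempty d] (h : Torus.IsStrainModelSolutionOn (Icc a b) ν u) (hab : a < b) {t : ℝ}
    (ht : t ∈ Icc a b) (i j : d) (x : UnitAddTorus d) :
    Torus.timeDerivWithin (Icc a b)
        (fun s y => (Torus.partialDeriv j (u s) y i + Torus.partialDeriv i (u s) y j) / 2) t x =
      ν * ((Torus.partialDeriv j (Torus.laplacian (u t)) x i +
          Torus.partialDeriv i (Torus.laplacian (u t)) x j) / 2) -
        (2 / 3 : ℝ) * Torus.strainProjection (fun a b y =>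
          ∑ c, ((Torus.partialDeriv c (u t) y a + Torus.partialDeriv a (u t) y c) / 2) *
            ((Torus.partialDeriv b (u t) y c + Torus.partialDeriv c (u t) y b) / 2)) i j x := by
  rw [timeDerivWithin_strain h.smooth hab ht i j x, h.symGrad_timeDerivWithin_eq ht i j x]

omit [DecidableEq d] in
/-- Reindexing the cubic invariant: `∑_{ij} S_{ij}(S²)_{ij} = ∑_{ijk} S_{ij}S_{jk}S_{ki} = tr(S³)` for a
symmetric array. [folklore] -/
private theorem sum_mul_sq_eq_trace_cube (S : d → d → ℝ) (hS : ∀ i j, S i j = S j i) :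
    ∑ i, ∑ j, (∑ k, S i k * S k j) * S i j = ∑ i, ∑ j, ∑ k, S i j * S j k * S k i := by
  rw [Finset.sum_comm]
  refine Finset.sum_congr rfl fun j _ => Finset.sum_congr rfl fun i _ => ?_
  rw [Finset.sum_mul]
  exact Finset.sum_congr rfl fun k _ => by rw [hS i j, hS k j, hS i k]; ring

/-- **The pairing `⟨S, ∂ₜS⟩` along the model**: `2⟨S, ∇_{sym}∂ₜu⟩ = −ν‖Δu‖²_{L²} − (4/3)∫tr(S³)`
(Miller's computation `2⟨∂ₜS, S⟩ = −2⟨−ΔS + ⅔P_{st}(S²), S⟩ = −2‖S‖²_{Ḣ¹} − (4/3)⟨S², S⟩`, "we have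
used the fact that `S ∈ L²_{st}` to drop the projection `P_{st}`"; here `‖S‖²_{Ḣ¹} = ½‖Δu‖²`).
[cite: Miller2023StrainModel, Prop 4.3 (proof)] -/
theorem _root_.Literature.Analysis.FluidPDE.Torus.IsStrainModelSolutionOn.two_mul_integral_sum_strain_mul_eq
    [Nonempty d] (h : Torus.IsStrainModelSolutionOn (Icc a b) ν u) {t : ℝ} (ht : t ∈ Icc a b) :
    2 * ∫ x, ∑ i, ∑ j, ((Torus.partialDeriv j (u t) x i + Torus.partialDeriv i (u t) x j) / 2) *
        ((Torus.partialDeriv j (Torus.timeDerivWithin (Icc a b) u t) x i +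
          Torus.partialDeriv i (Torus.timeDerivWithin (Icc a b) u t) x j) / 2) =
      -(ν * ∫ x, ‖Torus.laplacian (u t) x‖ ^ 2) -
        (4 / 3 : ℝ) * ∫ x, ∑ i, ∑ j, ∑ k,
          ((Torus.partialDeriv j (u t) x i + Torus.partialDeriv i (u t) x j) / 2) *
          ((Torus.partialDeriv k (u t) x j + Torus.partialDeriv j (u t) x k) / 2) *
          ((Torus.partialDeriv i (u t) x k + Torus.partialDeriv k (u t) x i) / 2) := by
  have hut : Torus.IsSmooth (u t) := h.smooth.isSmooth_slice ht
  have hdiv : Torus.IsDivFree (u t) := h.divFree ht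
  have hΔ : Torus.IsSmooth (Torus.laplacian (u t)) := hut.laplacian
  set M : d → d → UnitAddTorus d → ℝ := fun a b y =>
    ∑ c, ((Torus.partialDeriv c (u t) y a + Torus.partialDeriv a (u t) y c) / 2) *
      ((Torus.partialDeriv b (u t) y c + Torus.partialDeriv c (u t) y b) / 2) with hM
  have hMs : ∀ a b, Torus.IsSmooth (M a b) := fun a b => isSmooth_strainSq hut a b
  -- the two pairings
  set S0 : d → d → UnitAddTorus d → ℝ := fun i j y =>
    (Torus.partialDeriv j (u t) y i + Torus.partialDeriv i (u t) y j) / 2 with hS0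
  set L0 : d → d → UnitAddTorus d → ℝ := fun i j y =>
    (Torus.partialDeriv j (Torus.laplacian (u t)) y i + Torus.partialDeriv i (Torus.laplacian (u t)) y j) / 2
    with hL0
  have hS0s : ∀ i j, Torus.IsSmooth (S0 i j) := fun i j => isSmooth_strain hut i j
  have hL0s : ∀ i j, Torus.IsSmooth (L0 i j) := fun i j => isSmooth_strain hΔ i j
  have hPs : ∀ i j, Torus.IsSmooth (Torus.strainProjection M i j) := fun i j =>
    Torus.isSmooth_strainProjection hMs i j
  -- substitute the model equation
  have hsub : ∀ x, ∑ i, ∑ j, S0 i j x *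
      ((Torus.partialDeriv j (Torus.timeDerivWithin (Icc a b) u t) x i +
        Torus.partialDeriv i (Torus.timeDerivWithin (Icc a b) u t) x j) / 2) =
      ν * ∑ i, ∑ j, S0 i j x * L0 i j x -
        (2 / 3 : ℝ) * ∑ i, ∑ j, Torus.strainProjection M i j x * S0 i j x := by
    intro x
    simp_rw [h.symGrad_timeDerivWithin_eq ht]
    simp only [hS0, hL0, Finset.mul_sum, ← Finset.sum_sub_distrib]
    exact Finset.sum_congr rfl fun i _ => Finset.sum_congr rfl fun j _ => by ring
  have iA : Integrable (fun x => ∑ i, ∑ j, S0 i j x * L0 i j x) volume :=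
    (isSmooth_sum _ fun i _ => isSmooth_sum _ fun j _ => smooth_mul (hS0s i j) (hL0s i j)).integrable
  have iB : Integrable (fun x => ∑ i, ∑ j, Torus.strainProjection M i j x * S0 i j x) volume :=
    (isSmooth_sum _ fun i _ => isSmooth_sum _ fun j _ => smooth_mul (hPs i j) (hS0s i j)).integrable
  -- `⟨S, ΔS⟩ = −½‖Δu‖²`
  have hA : ∫ x, ∑ i, ∑ j, S0 i j x * L0 i j x = -(2⁻¹ * ∫ x, ‖Torus.laplacian (u t) x‖ ^ 2) := by
    have h1 := integral_sum_laplacianStrain_mul_symGrad_eq hut hdiv hut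
    have h2 : ∫ x, ∑ i, ∑ j, S0 i j x * L0 i j x =
        ∫ x, ∑ a, ∑ b, ((Torus.partialDeriv a (Torus.laplacian (u t)) x b +
          Torus.partialDeriv b (Torus.laplacian (u t)) x a) / 2) *
          ((Torus.partialDeriv a (u t) x b + Torus.partialDeriv b (u t) x a) / 2) :=
      integral_congr_ae (ae_of_all _ fun x =>
        Finset.sum_congr rfl fun a _ => Finset.sum_congr rfl fun b _ => by simp only [hS0, hL0]; ring)
    have h3 := Torus.integral_inner_laplacian_iterate_comm 1 hΔ hut
    simp only [Function.iterate_one] at h3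
    rw [h2, h1, h3]
    simp only [real_inner_self_eq_norm_sq]
  -- `⟨P_{st}(S²), S⟩ = ⟨S², S⟩ = ∫tr(S³)`
  have hB : ∫ x, ∑ i, ∑ j, Torus.strainProjection M i j x * S0 i j x =
      ∫ x, ∑ i, ∑ j, ∑ k, S0 i j x * S0 j k x * S0 k i x := by
    have h1 := Torus.integral_sum_strainProjection_mul_symGrad_eq hMs hut hdiv
    simp only [hS0]
    rw [h1]
    refine integral_congr_ae (ae_of_all _ fun x => ?_)
    have hsym : ∀ i j, S0 i j x = S0 j i x := fun i j => by simp only [hS0]; ring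
    have h3 := sum_mul_sq_eq_trace_cube (fun i j => S0 i j x) hsym
    simp only [hS0, hM] at h3 ⊢
    rw [← h3]
  rw [integral_congr_ae (ae_of_all _ hsub), integral_sub (iA.const_mul ν) (iB.const_mul _),
    MeasureTheory.integral_const_mul, MeasureTheory.integral_const_mul, hA, hB]
  simp only [hS0]
  ring

/-- **Prop 4.3 (the enstrophy identity of the model; Anal. PDE 16 (2023), Prop 1.9 for Navier–Stokes,
Prop 4.3 for the model): `∂ₜ‖S‖²_{L²} = −2‖S‖²_{Ḣ¹} − (4/3)∫tr(S³)` along a model solution on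
`[a, b] × T^d`**, here with viscosity `ν` and in the ladder variable `‖S‖²_{Ḣ¹} = ½‖Δu‖²_{L²}`
(tree `StrainProjectionCriterion.sum_integral_sum_partialDeriv_strain_sq_eq`):
`d/dt ∫∑_{ij}S_{ij}² = −ν∫‖Δu‖² − (4/3)∫∑_{ijk}S_{ij}S_{jk}S_{ki}` (one-sided within `[a, b]`).
[cite: Miller2023StrainModel, Prop 4.3 (with proof)] -/
theorem _root_.Literature.Analysis.FluidPDE.Torus.IsStrainModelSolutionOn.hasDerivWithinAt_strainNormSq
    [Nonempty d] (h : Torus.IsStrainModelSolutionOn (Icc a b) ν u) (hab : a < b) {t : ℝ}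
    (ht : t ∈ Icc a b) :
    HasDerivWithinAt
      (fun s => ∫ x, ∑ i, ∑ j, ((Torus.partialDeriv j (u s) x i + Torus.partialDeriv i (u s) x j) / 2) ^ 2)
      (-(ν * ∫ x, ‖Torus.laplacian (u t) x‖ ^ 2) -
        (4 / 3 : ℝ) * ∫ x, ∑ i, ∑ j, ∑ k,
          ((Torus.partialDeriv j (u t) x i + Torus.partialDeriv i (u t) x j) / 2) *
          ((Torus.partialDeriv k (u t) x j + Torus.partialDeriv j (u t) x k) / 2) *
          ((Torus.partialDeriv i (u t) x k + Torus.partialDeriv k (u t) x i) / 2))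
      (Icc a b) t := by
  rw [← h.two_mul_integral_sum_strain_mul_eq ht]
  exact hasDerivWithinAt_integral_sum_strain_sq h.smooth hab ht

/-! ### §4 The monotone functional `f = −3‖S‖²_{Ḣ¹} − (4/3)∫tr(S³)`: `∂ₜf = 6‖∂ₜS‖² ≥ 0` -/

/-- **`∂ₜf = 6‖∂ₜS‖²_{L²}` along the model**, `f = −3ν‖S‖²_{Ḣ¹} − (4/3)∫tr(S³) = −(3ν/2)‖Δu‖² −
(4/3)∫∑S_{ij}S_{jk}S_{ki}` (the first display in the proof of Prop 5.1:
`6‖−ΔS + ⅔P_{st}(S²)‖²_{L²} = 6‖∂ₜS‖²`). Proof: `∂ₜf = 6ν⟨ΔS, ∂ₜS⟩ − 4⟨S², ∂ₜS⟩` (the balances of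
`½‖Δu‖²` and of `∫tr(S³)`), `νΔS = ∂ₜS + ⅔P_{st}(S²)`, and `⟨P_{st}(S²), ∂ₜS⟩ = ⟨S², ∂ₜS⟩` because
`∂ₜS = ∇_{sym}∂ₜu` with `∂ₜu` divergence free. [cite: Miller2023StrainModel, Prop 5.1 (proof, `∂ₜg`, first display)] -/
theorem _root_.Literature.Analysis.FluidPDE.Torus.IsStrainModelSolutionOn.hasDerivWithinAt_strainFlux
    [Nonempty d] (h : Torus.IsStrainModelSolutionOn (Icc a b) ν u) (hab : a < b) {t : ℝ}
    (ht : t ∈ Icc a b) :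
    HasDerivWithinAt
      (fun s => -(3 * ν) * (2⁻¹ * ∫ x, ‖Torus.laplacian (u s) x‖ ^ 2) -
        (4 / 3 : ℝ) * ∫ x, ∑ i, ∑ j, ∑ k,
          ((Torus.partialDeriv j (u s) x i + Torus.partialDeriv i (u s) x j) / 2) *
          ((Torus.partialDeriv k (u s) x j + Torus.partialDeriv j (u s) x k) / 2) *
          ((Torus.partialDeriv i (u s) x k + Torus.partialDeriv k (u s) x i) / 2))
      (6 * ∫ x, ∑ i, ∑ j,
        ((Torus.partialDeriv j (Torus.timeDerivWithin (Icc a b) u t) x i +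
          Torus.partialDeriv i (Torus.timeDerivWithin (Icc a b) u t) x j) / 2) ^ 2)
      (Icc a b) t := by
  have hS : UniqueDiffOn ℝ (Icc a b) := uniqueDiffOn_Icc hab
  have hut : Torus.IsSmooth (u t) := h.smooth.isSmooth_slice ht
  have hdiv : Torus.IsDivFree (u t) := h.divFree ht
  have hΔ : Torus.IsSmooth (Torus.laplacian (u t)) := hut.laplacian
  have hw : Torus.IsSmooth (Torus.timeDerivWithin (Icc a b) u t) := h.smooth.isSmooth_timeDerivWithin hS ht
  have hdivw : Torus.IsDivFree (Torus.timeDerivWithin (Icc a b) u t) :=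
    isDivFree_timeDerivWithin h.smooth hab (fun s hs => h.divFree hs) ht
  have hH := hasDerivWithinAt_half_integral_norm_sq_laplacian h.smooth hab ht
  have hC := hasDerivWithinAt_integral_trace_strain_cube h.smooth hab ht
  refine ((hH.const_mul (-(3 * ν))).sub (hC.const_mul (4 / 3 : ℝ))).congr_deriv ?_
  rw [integral_inner_laplacian_laplacian_eq hw hut hdiv]
  -- abbreviations
  set M : d → d → UnitAddTorus d → ℝ := fun a b y =>
    ∑ c, ((Torus.partialDeriv c (u t) y a + Torus.partialDeriv a (u t) y c) / 2) *
      ((Torus.partialDeriv b (u t) y c + Torus.partialDeriv c (u t) y b) / 2) with hM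
  have hMs : ∀ a b, Torus.IsSmooth (M a b) := fun a b => isSmooth_strainSq hut a b
  set Sd : d → d → UnitAddTorus d → ℝ := fun i j y =>
    (Torus.partialDeriv j (Torus.timeDerivWithin (Icc a b) u t) y i +
      Torus.partialDeriv i (Torus.timeDerivWithin (Icc a b) u t) y j) / 2 with hSd
  set L0 : d → d → UnitAddTorus d → ℝ := fun i j y =>
    (Torus.partialDeriv j (Torus.laplacian (u t)) y i + Torus.partialDeriv i (Torus.laplacian (u t)) y j) / 2
    with hL0
  have hSds : ∀ i j, Torus.IsSmooth (Sd i j) := fun i j => isSmooth_strain hw i j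
  have hL0s : ∀ i j, Torus.IsSmooth (L0 i j) := fun i j => isSmooth_strain hΔ i j
  have hPs : ∀ i j, Torus.IsSmooth (Torus.strainProjection M i j) := fun i j =>
    Torus.isSmooth_strainProjection hMs i j
  -- the model equation, pointwise: `νΔS = ∂ₜS + ⅔P_{st}(S²)`
  have hmod : ∀ x i j, ν * L0 i j x = Sd i j x + (2 / 3 : ℝ) * Torus.strainProjection M i j x := by
    intro x i j
    have e := h.symGrad_timeDerivWithin_eq ht i j x
    simp only [hSd, hL0, hM] at e ⊢
    rw [e]
    ring
  -- `⟨P_{st}(S²), ∂ₜS⟩ = ⟨S², ∂ₜS⟩`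
  have hproj : ∫ x, ∑ i, ∑ j, Torus.strainProjection M i j x * Sd i j x =
      ∫ x, ∑ i, ∑ j, M i j x * Sd i j x := by
    simp only [hSd]
    exact Torus.integral_sum_strainProjection_mul_symGrad_eq hMs hw hdivw
  -- rewrite `∫∑ Sd·νL0 = ∫∑ Sd² + ⅔∫∑ P(S²)·Sd`
  have iSS : Integrable (fun x => ∑ i, ∑ j, Sd i j x ^ 2) volume :=
    (isSmooth_sum _ fun i _ => isSmooth_sum _ fun j _ => smooth_sq (hSds i j)).integrable
  have iPS : Integrable (fun x => ∑ i, ∑ j, Torus.strainProjection M i j x * Sd i j x) volume :=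
    (isSmooth_sum _ fun i _ => isSmooth_sum _ fun j _ => smooth_mul (hPs i j) (hSds i j)).integrable
  have h1 : ν * ∫ x, ∑ i, ∑ j, Sd i j x * L0 i j x =
      (∫ x, ∑ i, ∑ j, Sd i j x ^ 2) +
        (2 / 3 : ℝ) * ∫ x, ∑ i, ∑ j, Torus.strainProjection M i j x * Sd i j x := by
    rw [← MeasureTheory.integral_const_mul, ← MeasureTheory.integral_const_mul, ← integral_add iSS (iPS.const_mul _)]
    refine integral_congr_ae (ae_of_all _ fun x => ?_)
    simp only [Finset.mul_sum, ← Finset.sum_add_distrib]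
    refine Finset.sum_congr rfl fun i _ => Finset.sum_congr rfl fun j _ => ?_
    have e := hmod x i j
    calc ν * (Sd i j x * L0 i j x) = Sd i j x * (ν * L0 i j x) := by ring
      _ = Sd i j x ^ 2 + 2 / 3 * (Torus.strainProjection M i j x * Sd i j x) := by rw [e]; ring
  -- the cubic pairing is `⟨S², ∂ₜS⟩` with `(S²)_{ij} = M_{ij}`
  have h2 : ∫ x, ∑ i, ∑ j, Sd i j x * M i j x = ∫ x, ∑ i, ∑ j, M i j x * Sd i j x :=
    integral_congr_ae (ae_of_all _ fun x =>
      Finset.sum_congr rfl fun i _ => Finset.sum_congr rfl fun j _ => by ring)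
  show -(3 * ν) * -(2 * ∫ x, ∑ i, ∑ j, Sd i j x * L0 i j x) -
      4 / 3 * (3 * ∫ x, ∑ i, ∑ j, Sd i j x * M i j x) = 6 * ∫ x, ∑ i, ∑ j, Sd i j x ^ 2
  rw [h2]
  linear_combination 6 * h1 + 4 * hproj

/-! ### §5 Real-variable comparison: the core of Prop 5.1 / Thm 5.3 -/

section ODE

variable {E F E' F' : ℝ → ℝ} {T : ℝ}

/-- Monotonicity from a nonnegative one-sided derivative within `[0, T]`. [folklore] -/
private theorem monotoneOn_Icc_of_hasDerivWithinAt {f f' : ℝ → ℝ}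
    (hf : ∀ t ∈ Icc 0 T, HasDerivWithinAt f (f' t) (Icc 0 T) t) (hf' : ∀ t ∈ Icc 0 T, 0 ≤ f' t) :
    MonotoneOn f (Icc 0 T) := by
  refine monotoneOn_of_hasDerivWithinAt_nonneg (f' := f') (convex_Icc 0 T)
    (fun t ht => (hf t ht).continuousWithinAt) (fun t ht => ?_) (fun t ht => ?_)
  · have ht' : t ∈ Icc 0 T := interior_subset ht
    exact (hf t ht').mono interior_subset
  · exact hf' t (interior_subset ht)

/-- Antitonicity from a nonpositive one-sided derivative within `[0, T]`. [folklore] -/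
private theorem antitoneOn_Icc_of_hasDerivWithinAt {f f' : ℝ → ℝ}
    (hf : ∀ t ∈ Icc 0 T, HasDerivWithinAt f (f' t) (Icc 0 T) t) (hf' : ∀ t ∈ Icc 0 T, f' t ≤ 0) :
    AntitoneOn f (Icc 0 T) := by
  refine antitoneOn_of_hasDerivWithinAt_nonpos (f' := f') (convex_Icc 0 T)
    (fun t ht => (hf t ht).continuousWithinAt) (fun t ht => ?_) (fun t ht => ?_)
  · have ht' : t ∈ Icc 0 T := interior_subset ht
    exact (hf t ht').mono interior_subset
  · exact hf' t (interior_subset ht)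

omit [Fintype d] [DecidableEq d] in
/-- Powers of `√E`: `√E² = E`, `√E³ = E√E`, `√E⁴ = E²`. [folklore] -/
private theorem sqrt_pow_facts {e : ℝ} (he : 0 ≤ e) :
    Real.sqrt e ^ 2 = e ∧ Real.sqrt e ^ 3 = e * Real.sqrt e ∧ Real.sqrt e ^ 4 = e ^ 2 := by
  have h2 : Real.sqrt e ^ 2 = e := Real.sq_sqrt he
  refine ⟨h2, ?_, ?_⟩
  · rw [pow_succ, h2]
  · rw [show (4 : ℕ) = 2 * 2 from rfl, pow_mul, h2]

/-- **Step 1 (`f` is non-decreasing).** [cite: Miller2023StrainModel, Prop 5.1 (proof)] -/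
theorem ode_flux_ge (hF : ∀ t ∈ Icc 0 T, HasDerivWithinAt F (F' t) (Icc 0 T) t)
    (hF'nn : ∀ t ∈ Icc 0 T, 0 ≤ F' t) {t : ℝ} (ht : t ∈ Icc 0 T) : F 0 ≤ F t :=
  monotoneOn_Icc_of_hasDerivWithinAt hF hF'nn (Set.left_mem_Icc.2 (ht.1.trans ht.2)) ht ht.1

/-- **Step 2 (`E` stays positive).** If `F ≥ F(0) > 0`, `E ≥ 0` and `E = 0 ⇒ F ≤ 0`, then `E > 0` on
`[0, T]` (so that `g = f/‖S‖³_{L²}` in the proof of Prop 5.1 is well defined).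
[cite: Miller2023StrainModel, Prop 5.1 (proof)] -/
theorem ode_energy_pos (hF : ∀ t ∈ Icc 0 T, HasDerivWithinAt F (F' t) (Icc 0 T) t)
    (hF'nn : ∀ t ∈ Icc 0 T, 0 ≤ F' t)
    (hEnn : ∀ t ∈ Icc 0 T, 0 ≤ E t) (hE0 : ∀ t ∈ Icc 0 T, E t = 0 → F t ≤ 0) (hF0 : 0 < F 0)
    {t : ℝ} (ht : t ∈ Icc 0 T) : 0 < E t := by
  have hFt : 0 < F t := hF0.trans_le (ode_flux_ge hF hF'nn ht)
  rcases (hEnn t ht).eq_or_lt with h | h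
  · exact absurd (hE0 t ht h.symm) (not_le.2 hFt)
  · exact h

/-- **Step 3 (`g = F/E^{3/2}` is non-decreasing while `F > 0`).** With `∂ₜF ≥ 0`,
`E'² ≤ (2/3)E·∂ₜF` (Cauchy–Schwarz: `E' = 2⟨S, ∂ₜS⟩`, `∂ₜF = 6‖∂ₜS‖²`, `E = ‖S‖²`) and `0 < F ≤ E'`:
`∂ₜg = E^{−5/2}(∂ₜF·E − (3/2)F E') ≥ 0` since `∂ₜF·E ≥ (3/2)E'² ≥ (3/2)E'F`. (Printed: "we can
conclude that for all `0 < t < T_max`, `∂ₜg(t) ≥ 0`"; the step `−(3/2)f·∂ₜE ≥ −(3/2)(∂ₜE)²` used there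
requires `∂ₜE ≥ 0`, which holds once `f > 0` — guaranteed here by `f(0) > 0` and Step 1.)
[cite: Miller2023StrainModel, Prop 5.1 (proof)] -/
theorem ode_ratio_monotoneOn (hE : ∀ t ∈ Icc 0 T, HasDerivWithinAt E (E' t) (Icc 0 T) t)
    (hF : ∀ t ∈ Icc 0 T, HasDerivWithinAt F (F' t) (Icc 0 T) t)
    (hF'nn : ∀ t ∈ Icc 0 T, 0 ≤ F' t) (hCS : ∀ t ∈ Icc 0 T, E' t ^ 2 ≤ 2 / 3 * E t * F' t)
    (hFE : ∀ t ∈ Icc 0 T, F t ≤ E' t)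
    (hEnn : ∀ t ∈ Icc 0 T, 0 ≤ E t) (hE0 : ∀ t ∈ Icc 0 T, E t = 0 → F t ≤ 0) (hF0 : 0 < F 0) :
    MonotoneOn (fun t => F t / (E t * Real.sqrt (E t))) (Icc 0 T) := by
  have hEpos : ∀ t ∈ Icc 0 T, 0 < E t := fun t ht => ode_energy_pos hF hF'nn hEnn hE0 hF0 ht
  -- derivative of `g = F · (E√E)⁻¹`
  have hder : ∀ t ∈ Icc 0 T, HasDerivWithinAt (fun s => F s / (E s * Real.sqrt (E s)))
      (F' t * (E t * Real.sqrt (E t))⁻¹ +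
        F t * (-(E' t * Real.sqrt (E t) + E t * (E' t / (2 * Real.sqrt (E t)))) /
          (E t * Real.sqrt (E t)) ^ 2)) (Icc 0 T) t := by
    intro t ht
    have hEt := hEpos t ht
    have hsq : 0 < Real.sqrt (E t) := Real.sqrt_pos.2 hEt
    have hD : HasDerivWithinAt (fun s => E s * Real.sqrt (E s))
        (E' t * Real.sqrt (E t) + E t * (E' t / (2 * Real.sqrt (E t)))) (Icc 0 T) t :=
      (hE t ht).fun_mul ((hE t ht).sqrt hEt.ne')
    have hDinv := hD.inv (mul_pos hEt hsq).ne'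
    have h := (hF t ht).mul hDinv
    have hfun : (fun s => F s / (E s * Real.sqrt (E s))) =
        F * (fun s => E s * Real.sqrt (E s))⁻¹ := by
      funext s; simp [div_eq_mul_inv]
    rw [hfun]
    exact h
  refine monotoneOn_Icc_of_hasDerivWithinAt hder fun t ht => ?_
  have hEt := hEpos t ht
  have hsq : 0 < Real.sqrt (E t) := Real.sqrt_pos.2 hEt
  obtain ⟨hsq2, hsq3, hsq4⟩ := sqrt_pow_facts hEt.le
  have hFt : 0 < F t := hF0.trans_le (ode_flux_ge hF hF'nn ht)
  have hE't : 0 < E' t := hFt.trans_le (hFE t ht)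
  -- the key inequality `F'E ≥ (3/2)E'² ≥ (3/2)E'F`
  have hkey : 0 ≤ F' t * E t - 3 / 2 * F t * E' t := by
    have h1 : 3 / 2 * E' t ^ 2 ≤ F' t * E t := by nlinarith [hCS t ht]
    have h2 : E' t * F t ≤ E' t ^ 2 := by nlinarith [hFE t ht, hE't.le]
    nlinarith
  -- rewrite the derivative as `√E·(F'E − (3/2)FE') / (E√E)²`
  have hD0 : E t * Real.sqrt (E t) ≠ 0 := (mul_pos hEt hsq).ne'
  have hexpr : F' t * (E t * Real.sqrt (E t))⁻¹ +
      F t * (-(E' t * Real.sqrt (E t) + E t * (E' t / (2 * Real.sqrt (E t)))) /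
        (E t * Real.sqrt (E t)) ^ 2) =
      Real.sqrt (E t) * (F' t * E t - 3 / 2 * F t * E' t) / (E t * Real.sqrt (E t)) ^ 2 := by
    field_simp
    ring_nf
    simp only [hsq2]
    ring
  rw [hexpr]
  positivity

/-- **Step 4 = Prop 5.1 under `f(0) > 0`: `∂ₜE ≥ g₀ E^{3/2}`**, `g₀ = F(0)/E(0)^{3/2}`, with
`E^{3/2} = E√E`. [cite: Miller2023StrainModel, Prop 5.1] -/
theorem ode_deriv_ge (hE : ∀ t ∈ Icc 0 T, HasDerivWithinAt E (E' t) (Icc 0 T) t)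
    (hF : ∀ t ∈ Icc 0 T, HasDerivWithinAt F (F' t) (Icc 0 T) t)
    (hF'nn : ∀ t ∈ Icc 0 T, 0 ≤ F' t) (hCS : ∀ t ∈ Icc 0 T, E' t ^ 2 ≤ 2 / 3 * E t * F' t)
    (hFE : ∀ t ∈ Icc 0 T, F t ≤ E' t)
    (hEnn : ∀ t ∈ Icc 0 T, 0 ≤ E t) (hE0 : ∀ t ∈ Icc 0 T, E t = 0 → F t ≤ 0) (hF0 : 0 < F 0)
    {t : ℝ} (ht : t ∈ Icc 0 T) :
    F 0 / (E 0 * Real.sqrt (E 0)) * (E t * Real.sqrt (E t)) ≤ E' t := by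
  have hEpos : ∀ t ∈ Icc 0 T, 0 < E t := fun t ht => ode_energy_pos hF hF'nn hEnn hE0 hF0 ht
  have h0 : (0 : ℝ) ∈ Icc 0 T := Set.left_mem_Icc.2 (ht.1.trans ht.2)
  have hg := ode_ratio_monotoneOn hE hF hF'nn hCS hFE hEnn hE0 hF0 h0 ht ht.1
  simp only at hg
  have hEt := hEpos t ht
  have hD : 0 < E t * Real.sqrt (E t) := mul_pos hEt (Real.sqrt_pos.2 hEt)
  calc F 0 / (E 0 * Real.sqrt (E 0)) * (E t * Real.sqrt (E t))
      ≤ F t / (E t * Real.sqrt (E t)) * (E t * Real.sqrt (E t)) :=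
        mul_le_mul_of_nonneg_right hg hD.le
    _ = F t := div_mul_cancel₀ _ hD.ne'
    _ ≤ E' t := hFE t ht

/-- **Step 5 = Thm 5.3: the Riccati comparison.** With `ψ = E^{−1/2}`, `∂ₜψ = −½E^{−3/2}∂ₜE ≤ −g₀/2`,
so `ψ(t) ≤ ψ(0)(1 − r₀t)`, `r₀ = F(0)/(2E(0))`; hence `1 − r₀t > 0`, `E(t) ≥ E(0)/(1 − r₀t)²` and
`t < 2E(0)/F(0)`. [cite: Miller2023StrainModel, Thm 5.3 (proof) and Prop 5.1] -/
theorem ode_riccati (hE : ∀ t ∈ Icc 0 T, HasDerivWithinAt E (E' t) (Icc 0 T) t)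
    (hF : ∀ t ∈ Icc 0 T, HasDerivWithinAt F (F' t) (Icc 0 T) t)
    (hF'nn : ∀ t ∈ Icc 0 T, 0 ≤ F' t) (hCS : ∀ t ∈ Icc 0 T, E' t ^ 2 ≤ 2 / 3 * E t * F' t)
    (hFE : ∀ t ∈ Icc 0 T, F t ≤ E' t)
    (hEnn : ∀ t ∈ Icc 0 T, 0 ≤ E t) (hE0 : ∀ t ∈ Icc 0 T, E t = 0 → F t ≤ 0) (hF0 : 0 < F 0)
    {t : ℝ} (ht : t ∈ Icc 0 T) :
    0 < 1 - F 0 / (2 * E 0) * t ∧ E 0 / (1 - F 0 / (2 * E 0) * t) ^ 2 ≤ E t ∧ t < 2 * E 0 / F 0 := by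
  have hEpos : ∀ t ∈ Icc 0 T, 0 < E t := fun t ht => ode_energy_pos hF hF'nn hEnn hE0 hF0 ht
  have h0 : (0 : ℝ) ∈ Icc 0 T := Set.left_mem_Icc.2 (ht.1.trans ht.2)
  have hE0p := hEpos 0 h0
  have hsq0p : 0 < Real.sqrt (E 0) := Real.sqrt_pos.2 hE0p
  obtain ⟨hsq02, -, -⟩ := sqrt_pow_facts hE0p.le
  -- `g₀ = F(0)/(E(0)√E(0))`
  obtain ⟨g₀, hg₀⟩ : ∃ g : ℝ, g = F 0 / (E 0 * Real.sqrt (E 0)) := ⟨_, rfl⟩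
  have hg₀p : 0 < g₀ := by rw [hg₀]; exact div_pos hF0 (mul_pos hE0p hsq0p)
  -- `χ(t) = E(t)^{−1/2} + (g₀/2)t` is non-increasing
  obtain ⟨χ, hχ⟩ : ∃ χ : ℝ → ℝ, χ = fun s => (Real.sqrt (E s))⁻¹ + g₀ / 2 * s := ⟨_, rfl⟩
  have hder : ∀ s ∈ Icc 0 T, HasDerivWithinAt χ
      (-(E' s / (2 * Real.sqrt (E s))) / Real.sqrt (E s) ^ 2 + g₀ / 2) (Icc 0 T) s := by
    intro s hs
    have hEs := hEpos s hs
    have h1 := ((hE s hs).sqrt hEs.ne').inv (Real.sqrt_pos.2 hEs).ne'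
    have h2 : HasDerivWithinAt (fun r => g₀ / 2 * r) (g₀ / 2) (Icc 0 T) s := by
      simpa using (hasDerivWithinAt_id s (Icc 0 T)).const_mul (g₀ / 2)
    rw [hχ]
    exact h1.add h2
  have hχanti : AntitoneOn χ (Icc 0 T) := by
    refine antitoneOn_Icc_of_hasDerivWithinAt hder fun s hs => ?_
    have hEs := hEpos s hs
    have hsq : 0 < Real.sqrt (E s) := Real.sqrt_pos.2 hEs
    obtain ⟨hsq2, -, -⟩ := sqrt_pow_facts hEs.le
    have hlow := ode_deriv_ge hE hF hF'nn hCS hFE hEnn hE0 hF0 hs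
    rw [← hg₀] at hlow
    -- `E' ≥ g₀ E√E` gives `E'/(2√E·E) ≥ g₀/2`
    rw [hsq2, neg_div]
    have hX : g₀ / 2 ≤ E' s / (2 * Real.sqrt (E s)) / E s := by
      rw [div_div, le_div_iff₀ (by positivity)]
      calc g₀ / 2 * (2 * Real.sqrt (E s) * E s) = g₀ * (E s * Real.sqrt (E s)) := by ring
        _ ≤ E' s := hlow
    linarith
  have hχle : χ t ≤ χ 0 := hχanti h0 ht ht.1
  have hEt := hEpos t ht
  have hψt : 0 < (Real.sqrt (E t))⁻¹ := inv_pos.2 (Real.sqrt_pos.2 hEt)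
  rw [hχ] at hχle
  simp only [mul_zero, add_zero] at hχle
  -- `r₀ = F(0)/(2E(0)) = (g₀/2)·√E(0)`, i.e. `g₀/2 = r₀ · ψ(0)` with `ψ(0) = (√E0)⁻¹`
  have hψ0 : 0 < (Real.sqrt (E 0))⁻¹ := inv_pos.2 hsq0p
  have hr : F 0 / (2 * E 0) = g₀ / 2 * Real.sqrt (E 0) := by
    rw [hg₀, eq_comm]
    field_simp
  have hr' : g₀ / 2 = F 0 / (2 * E 0) * (Real.sqrt (E 0))⁻¹ := by
    rw [hr, mul_assoc, mul_inv_cancel₀ hsq0p.ne', mul_one]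
  -- `ψ(t) ≤ ψ(0)·(1 − r₀t)` with `ψ(t) > 0`
  have hψle : (Real.sqrt (E t))⁻¹ ≤ (Real.sqrt (E 0))⁻¹ * (1 - F 0 / (2 * E 0) * t) := by
    have : (Real.sqrt (E 0))⁻¹ * (1 - F 0 / (2 * E 0) * t) = (Real.sqrt (E 0))⁻¹ - g₀ / 2 * t := by
      rw [hr']; ring
    rw [this]
    linarith
  have hi : 0 < 1 - F 0 / (2 * E 0) * t := by
    by_contra hneg
    rw [not_lt] at hneg
    have : (Real.sqrt (E 0))⁻¹ * (1 - F 0 / (2 * E 0) * t) ≤ 0 :=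
      mul_nonpos_of_nonneg_of_nonpos hψ0.le hneg
    linarith
  refine ⟨hi, ?_, ?_⟩
  · -- `E(t) = ψ(t)^{−2} ≥ (ψ(0)(1 − r₀t))^{−2} = E(0)/(1 − r₀t)²`
    have hpos2 : 0 < (Real.sqrt (E 0))⁻¹ * (1 - F 0 / (2 * E 0) * t) := mul_pos hψ0 hi
    have hsq_le : ((Real.sqrt (E t))⁻¹) ^ 2 ≤ ((Real.sqrt (E 0))⁻¹ * (1 - F 0 / (2 * E 0) * t)) ^ 2 :=
      pow_le_pow_left₀ hψt.le hψle 2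
    have hEt_eq : E t = (((Real.sqrt (E t))⁻¹) ^ 2)⁻¹ := by
      rw [inv_pow, inv_inv, Real.sq_sqrt hEt.le]
    have hE0_eq : E 0 / (1 - F 0 / (2 * E 0) * t) ^ 2 =
        (((Real.sqrt (E 0))⁻¹ * (1 - F 0 / (2 * E 0) * t)) ^ 2)⁻¹ := by
      rw [mul_pow, inv_pow, Real.sq_sqrt hE0p.le, mul_inv, inv_inv, div_eq_mul_inv]
    rw [hEt_eq, hE0_eq]
    exact inv_anti₀ (pow_pos hψt 2) hsq_le
  · -- `t < 2E(0)/F(0)`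
    have h1 : F 0 / (2 * E 0) * t < 1 := by linarith
    have h2 : F 0 * t < 2 * E 0 := by
      have := mul_lt_mul_of_pos_right h1 (mul_pos two_pos hE0p)
      rw [one_mul] at this
      calc F 0 * t = F 0 / (2 * E 0) * t * (2 * E 0) := by field_simp
        _ < 2 * E 0 := this
    rw [lt_div_iff₀ hF0]
    linarith

end ODE

/-! ### §6 Assembly: Prop 5.1 and Thm 5.3 (= Thm 1.11) for the model on `[0, T] × T^d` -/

section Blowup

variable {T : ℝ}

omit [DecidableEq d] in
/-- Cauchy–Schwarz for matrix fields, squared form: `(∫∑AB)² ≤ (∫∑A²)(∫∑B²)`. [folklore] -/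
private theorem integral_sum_sum_mul_sq_le {A B : d → d → UnitAddTorus d → ℝ}
    (hA : ∀ a b, Continuous (A a b)) (hB : ∀ a b, Continuous (B a b)) :
    (∫ x, ∑ a, ∑ b, A a b x * B a b x) ^ 2 ≤
      (∫ x, ∑ a, ∑ b, A a b x ^ 2) * ∫ x, ∑ a, ∑ b, B a b x ^ 2 := by
  have h1 := Torus.integral_sum_sum_mul_le_sqrt_mul_sqrt hA hB
  have h2 := Torus.integral_sum_sum_mul_le_sqrt_mul_sqrt (A := fun a b x => -A a b x)
    (fun a b => (hA a b).neg) hB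
  have e1 : ∫ x, ∑ a, ∑ b, (fun a b x => -A a b x) a b x * B a b x = -∫ x, ∑ a, ∑ b, A a b x * B a b x := by
    rw [← integral_neg]
    refine integral_congr_ae (ae_of_all _ fun x => ?_)
    simp only [neg_mul, Finset.sum_neg_distrib]
  have e2 : ∫ x, ∑ a, ∑ b, (fun a b x => -A a b x) a b x ^ 2 = ∫ x, ∑ a, ∑ b, A a b x ^ 2 :=
    integral_congr_ae (ae_of_all _ fun x =>
      Finset.sum_congr rfl fun a _ => Finset.sum_congr rfl fun b _ => by ring)
  rw [e1, e2] at h2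
  have hX : 0 ≤ ∫ x, ∑ a, ∑ b, A a b x ^ 2 :=
    integral_nonneg fun x => Finset.sum_nonneg fun a _ => Finset.sum_nonneg fun b _ => sq_nonneg _
  have hY : 0 ≤ ∫ x, ∑ a, ∑ b, B a b x ^ 2 :=
    integral_nonneg fun x => Finset.sum_nonneg fun a _ => Finset.sum_nonneg fun b _ => sq_nonneg _
  have habs : |∫ x, ∑ a, ∑ b, A a b x * B a b x| ≤
      Real.sqrt (∫ x, ∑ a, ∑ b, A a b x ^ 2) * Real.sqrt (∫ x, ∑ a, ∑ b, B a b x ^ 2) :=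
    abs_le.2 ⟨by linarith, h1⟩
  have h3 := pow_le_pow_left₀ (abs_nonneg _) habs 2
  rw [sq_abs, mul_pow, Real.sq_sqrt hX, Real.sq_sqrt hY] at h3
  exact h3

omit [DecidableEq d] in
/-- If `∫∑_{ij}S_{ij}² = 0` for a continuous matrix field then `S ≡ 0`. [folklore] -/
private theorem eq_zero_of_integral_sum_sq_eq_zero {S : d → d → UnitAddTorus d → ℝ}
    (hS : ∀ i j, Continuous (S i j)) (h0 : ∫ x, ∑ i, ∑ j, S i j x ^ 2 = 0) (i j : d)
    (x : UnitAddTorus d) : S i j x = 0 := by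
  have hcont : Continuous fun x => ∑ i, ∑ j, S i j x ^ 2 :=
    continuous_finsetSum _ fun i _ => continuous_finsetSum _ fun j _ => (hS i j).pow 2
  have hnn : 0 ≤ fun x => ∑ i, ∑ j, S i j x ^ 2 := fun x =>
    Finset.sum_nonneg fun i _ => Finset.sum_nonneg fun j _ => sq_nonneg _
  have hae := (integral_eq_zero_iff_of_nonneg hnn hcont.integrable_unitAddTorus).1 h0
  have hfun : (fun x => ∑ i, ∑ j, S i j x ^ 2) = 0 :=
    (Continuous.ae_eq_iff_eq volume hcont continuous_zero).1 hae
  have hx := congr_fun hfun x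
  simp only [Pi.zero_apply] at hx
  have hi := (Finset.sum_eq_zero_iff_of_nonneg fun i _ =>
    Finset.sum_nonneg fun j _ => sq_nonneg (S i j x)).1 hx i (Finset.mem_univ i)
  have hj := (Finset.sum_eq_zero_iff_of_nonneg fun j _ => sq_nonneg (S i j x)).1 hi j (Finset.mem_univ j)
  exact pow_eq_zero_iff (n := 2) (by norm_num) |>.1 hj

variable [Nonempty d]

/-- The hypotheses of the real-variable comparison lemmas hold along every model solution on
`[0, T] × T^d` with `ν ≥ 0`: with `E = ‖S‖²_{L²}`, `∂ₜE = 2⟨S, ∂ₜS⟩`,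
`f = −3ν‖S‖²_{Ḣ¹} − (4/3)∫tr S³`, `∂ₜf = 6‖∂ₜS‖²`: `∂ₜf ≥ 0`, `(∂ₜE)² ≤ (2/3)E∂ₜf` (Cauchy–Schwarz),
`f ≤ ∂ₜE` (`∂ₜE − f = ν‖S‖²_{Ḣ¹}`), `E ≥ 0`, `E = 0 ⇒ f ≤ 0`. [cite: Miller2023StrainModel, Prop 5.1 (proof)] -/
private theorem model_ode_hypotheses (h : Torus.IsStrainModelSolutionOn (Icc 0 T) ν u) (hT : 0 < T)
    (hν : 0 ≤ ν) :
    let E : ℝ → ℝ := fun s => ∫ x, ∑ i, ∑ j,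
      ((Torus.partialDeriv j (u s) x i + Torus.partialDeriv i (u s) x j) / 2) ^ 2
    let E' : ℝ → ℝ := fun s => 2 * ∫ x, ∑ i, ∑ j,
      ((Torus.partialDeriv j (u s) x i + Torus.partialDeriv i (u s) x j) / 2) *
        ((Torus.partialDeriv j (Torus.timeDerivWithin (Icc 0 T) u s) x i +
          Torus.partialDeriv i (Torus.timeDerivWithin (Icc 0 T) u s) x j) / 2)
    let F : ℝ → ℝ := fun s => -(3 * ν) * (2⁻¹ * ∫ x, ‖Torus.laplacian (u s) x‖ ^ 2) -
      (4 / 3 : ℝ) * ∫ x, ∑ i, ∑ j, ∑ k,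
        ((Torus.partialDeriv j (u s) x i + Torus.partialDeriv i (u s) x j) / 2) *
        ((Torus.partialDeriv k (u s) x j + Torus.partialDeriv j (u s) x k) / 2) *
        ((Torus.partialDeriv i (u s) x k + Torus.partialDeriv k (u s) x i) / 2)
    let F' : ℝ → ℝ := fun s => 6 * ∫ x, ∑ i, ∑ j,
      ((Torus.partialDeriv j (Torus.timeDerivWithin (Icc 0 T) u s) x i +
        Torus.partialDeriv i (Torus.timeDerivWithin (Icc 0 T) u s) x j) / 2) ^ 2
    (∀ t ∈ Icc 0 T, HasDerivWithinAt E (E' t) (Icc 0 T) t) ∧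
    (∀ t ∈ Icc 0 T, HasDerivWithinAt F (F' t) (Icc 0 T) t) ∧
    (∀ t ∈ Icc 0 T, 0 ≤ F' t) ∧ (∀ t ∈ Icc 0 T, E' t ^ 2 ≤ 2 / 3 * E t * F' t) ∧
    (∀ t ∈ Icc 0 T, F t ≤ E' t) ∧ (∀ t ∈ Icc 0 T, 0 ≤ E t) ∧
    (∀ t ∈ Icc 0 T, E t = 0 → F t ≤ 0) := by
  intro E E' F F'
  refine ⟨fun t ht => hasDerivWithinAt_integral_sum_strain_sq h.smooth hT ht,
    fun t ht => h.hasDerivWithinAt_strainFlux hT ht, fun t ht => ?_, fun t ht => ?_, fun t ht => ?_,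
    fun t ht => ?_, fun t ht => ?_⟩
  · exact mul_nonneg (by norm_num) (integral_nonneg fun x =>
      Finset.sum_nonneg fun i _ => Finset.sum_nonneg fun j _ => sq_nonneg _)
  · -- Cauchy–Schwarz
    have hS := hasDerivWithinAt_integral_sum_strain_sq h.smooth hT ht
    have hut : Torus.IsSmooth (u t) := h.smooth.isSmooth_slice ht
    have hw : Torus.IsSmooth (Torus.timeDerivWithin (Icc 0 T) u t) :=
      h.smooth.isSmooth_timeDerivWithin (uniqueDiffOn_Icc hT) ht
    have hcs := integral_sum_sum_mul_sq_le
      (A := fun i j x => (Torus.partialDeriv j (u t) x i + Torus.partialDeriv i (u t) x j) / 2)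
      (B := fun i j x => (Torus.partialDeriv j (Torus.timeDerivWithin (Icc 0 T) u t) x i +
        Torus.partialDeriv i (Torus.timeDerivWithin (Icc 0 T) u t) x j) / 2)
      (fun i j => (isSmooth_strain hut i j).continuous) (fun i j => (isSmooth_strain hw i j).continuous)
    simp only [E, E', F']
    nlinarith [hcs]
  · -- `f ≤ ∂ₜE`: `∂ₜE − f = ν·½‖Δu‖² ≥ 0`
    simp only [E', F]
    rw [h.two_mul_integral_sum_strain_mul_eq ht]
    have hpos : 0 ≤ ∫ x, ‖Torus.laplacian (u t) x‖ ^ 2 := integral_nonneg fun x => sq_nonneg _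
    nlinarith
  · exact integral_nonneg fun x => Finset.sum_nonneg fun i _ => Finset.sum_nonneg fun j _ => sq_nonneg _
  · -- `E = 0 ⇒ S ≡ 0 ⇒ ∫tr S³ = 0 ⇒ f = −(3ν/2)‖Δu‖² ≤ 0`
    intro hE0
    have hut : Torus.IsSmooth (u t) := h.smooth.isSmooth_slice ht
    have hzero := eq_zero_of_integral_sum_sq_eq_zero (fun i j => (isSmooth_strain hut i j).continuous) hE0
    simp only [F]
    have hC : ∫ x, ∑ i, ∑ j, ∑ k,
        ((Torus.partialDeriv j (u t) x i + Torus.partialDeriv i (u t) x j) / 2) *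
        ((Torus.partialDeriv k (u t) x j + Torus.partialDeriv j (u t) x k) / 2) *
        ((Torus.partialDeriv i (u t) x k + Torus.partialDeriv k (u t) x i) / 2) = 0 := by
      have hfun : (fun x => ∑ i, ∑ j, ∑ k,
          ((Torus.partialDeriv j (u t) x i + Torus.partialDeriv i (u t) x j) / 2) *
          ((Torus.partialDeriv k (u t) x j + Torus.partialDeriv j (u t) x k) / 2) *
          ((Torus.partialDeriv i (u t) x k + Torus.partialDeriv k (u t) x i) / 2)) = fun _ => 0 := by
        funext x
        refine Finset.sum_eq_zero fun i _ => Finset.sum_eq_zero fun j _ => Finset.sum_eq_zero fun k _ => ?_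
        rw [hzero i j x]
        ring
      rw [hfun, integral_zero]
    rw [hC, mul_zero, sub_zero]
    have hpos : 0 ≤ ∫ x, ‖Torus.laplacian (u t) x‖ ^ 2 := integral_nonneg fun x => sq_nonneg _
    nlinarith

/-- **`f` is non-decreasing along the model** (the first half of the proof of Prop 5.1: `∂ₜf = 6‖∂ₜS‖²
≥ 0`): for every model solution on `[0, T] × T^d`, `ν ≥ 0`, and every `t ∈ [0, T]`,
`f(0) ≤ f(t)`, `f = −(3ν/2)‖Δu‖² − (4/3)∫∑S_{ij}S_{jk}S_{ki} = −3ν‖S‖²_{Ḣ¹} − (4/3)∫tr(S³)`.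
[cite: Miller2023StrainModel, Prop 5.1 (proof)] -/
theorem _root_.Literature.Analysis.FluidPDE.Torus.IsStrainModelSolutionOn.strainFlux_le
    (h : Torus.IsStrainModelSolutionOn (Icc 0 T) ν u) (hT : 0 < T) (hν : 0 ≤ ν)
    {t : ℝ} (ht : t ∈ Icc 0 T) :
    -(3 * ν) * (2⁻¹ * ∫ x, ‖Torus.laplacian (u 0) x‖ ^ 2) -
      (4 / 3 : ℝ) * ∫ x, ∑ i, ∑ j, ∑ k,
        ((Torus.partialDeriv j (u 0) x i + Torus.partialDeriv i (u 0) x j) / 2) *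
        ((Torus.partialDeriv k (u 0) x j + Torus.partialDeriv j (u 0) x k) / 2) *
        ((Torus.partialDeriv i (u 0) x k + Torus.partialDeriv k (u 0) x i) / 2) ≤
    -(3 * ν) * (2⁻¹ * ∫ x, ‖Torus.laplacian (u t) x‖ ^ 2) -
      (4 / 3 : ℝ) * ∫ x, ∑ i, ∑ j, ∑ k,
        ((Torus.partialDeriv j (u t) x i + Torus.partialDeriv i (u t) x j) / 2) *
        ((Torus.partialDeriv k (u t) x j + Torus.partialDeriv j (u t) x k) / 2) *
        ((Torus.partialDeriv i (u t) x k + Torus.partialDeriv k (u t) x i) / 2) := by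
  obtain ⟨-, hF, hF'nn, -, -, -, -⟩ := model_ode_hypotheses h hT hν
  exact ode_flux_ge hF hF'nn ht

/-- **Miller, Anal. PDE 16 (2023), Prop 5.1 (the `3/2`-power law of enstrophy growth for the strain
self-amplification model), on `[0, T] × T^d`.** "Suppose `S ∈ C([0,T_max); H¹_{st})` is a mild
solution of the strain self-amplification model equation. Then for all `0 ≤ t < T_max`,
`∂ₜE(t) ≥ g₀E(t)^{3/2}`, where `g₀ = (−3‖S⁰‖²_{Ḣ¹} − 4∫det(S⁰))/‖S⁰‖³_{L²}`." Here: for a classical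
model solution with viscosity `ν ≥ 0` and `f₀ := −(3ν/2)‖Δu(0)‖² − (4/3)∫tr(S(0)³) > 0`
(`= −3ν‖S⁰‖²_{Ḣ¹} − 4∫det S⁰` on `T³`, `∫det S = ⅓∫tr S³` for trace-free `S`), for all `t ∈ [0, T]`:
`∂ₜE(t) = −ν‖Δu(t)‖² − (4/3)∫tr(S(t)³) ≥ (f₀/(E₀√E₀))·E(t)√E(t)`, `E = ‖S‖²_{L²} = ∫∑S_{ij}²`.
SCOPE: the printed proposition has no sign hypothesis on `g₀`; its proof ("`∂ₜg ≥ 0`") uses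
`−(3/2)f∂ₜE ≥ −(3/2)(∂ₜE)²`, valid when `∂ₜE ≥ 0`, hence whenever `f > 0`; we type the case
`f₀ > 0` (then `f ≥ f₀ > 0` throughout by monotonicity of `f`), which is the one used in Thm 5.3 /
Thm 1.11. [cite: Miller2023StrainModel, Prop 5.1] -/
theorem _root_.Literature.Analysis.FluidPDE.Torus.IsStrainModelSolutionOn.strainNormSq_deriv_ge
    (h : Torus.IsStrainModelSolutionOn (Icc 0 T) ν u) (hT : 0 < T) (hν : 0 ≤ ν)
    (hf₀ : 0 < -(3 * ν) * (2⁻¹ * ∫ x, ‖Torus.laplacian (u 0) x‖ ^ 2) -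
      (4 / 3 : ℝ) * ∫ x, ∑ i, ∑ j, ∑ k,
        ((Torus.partialDeriv j (u 0) x i + Torus.partialDeriv i (u 0) x j) / 2) *
        ((Torus.partialDeriv k (u 0) x j + Torus.partialDeriv j (u 0) x k) / 2) *
        ((Torus.partialDeriv i (u 0) x k + Torus.partialDeriv k (u 0) x i) / 2))
    {t : ℝ} (ht : t ∈ Icc 0 T) :
    (-(3 * ν) * (2⁻¹ * ∫ x, ‖Torus.laplacian (u 0) x‖ ^ 2) -
      (4 / 3 : ℝ) * ∫ x, ∑ i, ∑ j, ∑ k,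
        ((Torus.partialDeriv j (u 0) x i + Torus.partialDeriv i (u 0) x j) / 2) *
        ((Torus.partialDeriv k (u 0) x j + Torus.partialDeriv j (u 0) x k) / 2) *
        ((Torus.partialDeriv i (u 0) x k + Torus.partialDeriv k (u 0) x i) / 2)) /
      ((∫ x, ∑ i, ∑ j, ((Torus.partialDeriv j (u 0) x i + Torus.partialDeriv i (u 0) x j) / 2) ^ 2) *
        Real.sqrt (∫ x, ∑ i, ∑ j,
          ((Torus.partialDeriv j (u 0) x i + Torus.partialDeriv i (u 0) x j) / 2) ^ 2)) *
      ((∫ x, ∑ i, ∑ j, ((Torus.partialDeriv j (u t) x i + Torus.partialDeriv i (u t) x j) / 2) ^ 2) *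
        Real.sqrt (∫ x, ∑ i, ∑ j,
          ((Torus.partialDeriv j (u t) x i + Torus.partialDeriv i (u t) x j) / 2) ^ 2)) ≤
    -(ν * ∫ x, ‖Torus.laplacian (u t) x‖ ^ 2) -
      (4 / 3 : ℝ) * ∫ x, ∑ i, ∑ j, ∑ k,
        ((Torus.partialDeriv j (u t) x i + Torus.partialDeriv i (u t) x j) / 2) *
        ((Torus.partialDeriv k (u t) x j + Torus.partialDeriv j (u t) x k) / 2) *
        ((Torus.partialDeriv i (u t) x k + Torus.partialDeriv k (u t) x i) / 2) := by
  obtain ⟨hE, hF, hF'nn, hCS, hFE, hEnn, hE0⟩ := model_ode_hypotheses h hT hν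
  have key := ode_deriv_ge hE hF hF'nn hCS hFE hEnn hE0 hf₀ ht
  rw [h.two_mul_integral_sum_strain_mul_eq ht] at key
  exact key

/-- **Miller, Anal. PDE 16 (2023), Thm 5.3 = Thm 1.11 (finite-time blowup for the strain
self-amplification model), on `[0, T] × T^d`.** "Suppose `S ∈ C([0,T_max); H¹_{st})` is a mild
solution of the strain self-amplification model equation, such that `−3‖S⁰‖²_{Ḣ¹} − 4∫det(S⁰) > 0`.
Then for all `0 ≤ t < T_max`, `E(t) > E₀/(1 − r₀t)²`, where `r₀ = (−3‖S⁰‖²_{Ḣ¹} − 4∫det(S⁰))/(2‖S⁰‖²_{L²})`.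
Note in particular that this implies `T_max < 2‖S⁰‖²_{L²}/(−3‖S⁰‖²_{Ḣ¹} − 4∫det(S⁰))`" [both arXiv
displays (Thm 1.11 and Thm 5.3, also the last line of its proof) print `‖S⁰‖²_{L²}` inside the last
denominator and `r₀` with `−4det(S⁰)` unintegrated; `T_max < 1/r₀` with `∫det S⁰` is meant and is what
is typed]. Here, for a classical model
solution with viscosity `ν ≥ 0` on the CLOSED interval `[0, T]` (`T > 0`) and
`f₀ = −(3ν/2)‖Δu(0)‖² − (4/3)∫tr(S(0)³) > 0`, `E = ‖S‖²_{L²} = ∫∑S_{ij}²`, `r₀ = f₀/(2E₀)`: for all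
`t ∈ [0, T]`, `1 − r₀t > 0` and `E(t) ≥ E₀/(1 − r₀t)²`; and `T < 2E₀/f₀` — no classical model solution
with such data exists on `[0, T]` once `T ≥ 2E₀/f₀`. (The `λ₂⁺` consequence `∫‖λ₂⁺‖^p_{L^q} = ∞` of
Thm 1.11, which rests on the model's `λ₂⁺` criterion Thm 4.8, is not typed.)
[cite: Miller2023StrainModel, Thm 5.3 = Thm 1.11] -/
theorem _root_.Literature.Analysis.FluidPDE.Torus.IsStrainModelSolutionOn.strainNormSq_ge_and_time_lt
    (h : Torus.IsStrainModelSolutionOn (Icc 0 T) ν u) (hT : 0 < T) (hν : 0 ≤ ν)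
    (hf₀ : 0 < -(3 * ν) * (2⁻¹ * ∫ x, ‖Torus.laplacian (u 0) x‖ ^ 2) -
      (4 / 3 : ℝ) * ∫ x, ∑ i, ∑ j, ∑ k,
        ((Torus.partialDeriv j (u 0) x i + Torus.partialDeriv i (u 0) x j) / 2) *
        ((Torus.partialDeriv k (u 0) x j + Torus.partialDeriv j (u 0) x k) / 2) *
        ((Torus.partialDeriv i (u 0) x k + Torus.partialDeriv k (u 0) x i) / 2))
    {t : ℝ} (ht : t ∈ Icc 0 T) :
    let E₀ : ℝ := ∫ x, ∑ i, ∑ j, ((Torus.partialDeriv j (u 0) x i + Torus.partialDeriv i (u 0) x j) / 2) ^ 2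
    let f₀ : ℝ := -(3 * ν) * (2⁻¹ * ∫ x, ‖Torus.laplacian (u 0) x‖ ^ 2) -
      (4 / 3 : ℝ) * ∫ x, ∑ i, ∑ j, ∑ k,
        ((Torus.partialDeriv j (u 0) x i + Torus.partialDeriv i (u 0) x j) / 2) *
        ((Torus.partialDeriv k (u 0) x j + Torus.partialDeriv j (u 0) x k) / 2) *
        ((Torus.partialDeriv i (u 0) x k + Torus.partialDeriv k (u 0) x i) / 2)
    0 < 1 - f₀ / (2 * E₀) * t ∧
      E₀ / (1 - f₀ / (2 * E₀) * t) ^ 2 ≤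
        ∫ x, ∑ i, ∑ j, ((Torus.partialDeriv j (u t) x i + Torus.partialDeriv i (u t) x j) / 2) ^ 2 ∧
      T < 2 * E₀ / f₀ := by
  intro E₀ f₀
  obtain ⟨hE, hF, hF'nn, hCS, hFE, hEnn, hE0⟩ := model_ode_hypotheses h hT hν
  have hTmem : T ∈ Icc 0 T := Set.right_mem_Icc.2 hT.le
  obtain ⟨h1, h2, -⟩ := ode_riccati hE hF hF'nn hCS hFE hEnn hE0 hf₀ ht
  obtain ⟨-, -, h3⟩ := ode_riccati hE hF hF'nn hCS hFE hEnn hE0 hf₀ hTmem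
  exact ⟨h1, h2, h3⟩

/-- **Thm 5.3 / Thm 1.11, the bound on the existence time alone**: a classical solution of the
strain self-amplification model on `[0, T] × T^d` (`ν ≥ 0`) with
`f₀ = −(3ν/2)‖Δu(0)‖² − (4/3)∫tr(S(0)³) > 0` has `T < 2‖S(0)‖²_{L²}/f₀` ("`T_max < 2‖S⁰‖²_{L²}/(−3‖S⁰‖²_{Ḣ¹}
− 4∫det S⁰)`"). [cite: Miller2023StrainModel, Thm 5.3 = Thm 1.11] -/
theorem _root_.Literature.Analysis.FluidPDE.Torus.IsStrainModelSolutionOn.time_lt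
    (h : Torus.IsStrainModelSolutionOn (Icc 0 T) ν u) (hT : 0 < T) (hν : 0 ≤ ν)
    (hf₀ : 0 < -(3 * ν) * (2⁻¹ * ∫ x, ‖Torus.laplacian (u 0) x‖ ^ 2) -
      (4 / 3 : ℝ) * ∫ x, ∑ i, ∑ j, ∑ k,
        ((Torus.partialDeriv j (u 0) x i + Torus.partialDeriv i (u 0) x j) / 2) *
        ((Torus.partialDeriv k (u 0) x j + Torus.partialDeriv j (u 0) x k) / 2) *
        ((Torus.partialDeriv i (u 0) x k + Torus.partialDeriv k (u 0) x i) / 2)) :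
    T < 2 * (∫ x, ∑ i, ∑ j, ((Torus.partialDeriv j (u 0) x i + Torus.partialDeriv i (u 0) x j) / 2) ^ 2) /
      (-(3 * ν) * (2⁻¹ * ∫ x, ‖Torus.laplacian (u 0) x‖ ^ 2) -
        (4 / 3 : ℝ) * ∫ x, ∑ i, ∑ j, ∑ k,
          ((Torus.partialDeriv j (u 0) x i + Torus.partialDeriv i (u 0) x j) / 2) *
          ((Torus.partialDeriv k (u 0) x j + Torus.partialDeriv j (u 0) x k) / 2) *
          ((Torus.partialDeriv i (u 0) x k + Torus.partialDeriv k (u 0) x i) / 2)) :=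
  (h.strainNormSq_ge_and_time_lt hT hν hf₀ (Set.right_mem_Icc.2 hT.le)).2.2

/-- **Thm 1.11 in the cell's ladder variables**: since `‖S‖²_{L²} = ℰ(u) = ½‖∇u‖²`
(`torusEnstrophy`, tree `integral_strainNormSq_eq_torusEnstrophy`), the existence time of a classical
model solution on `[0, T] × T^d` with `f₀ > 0` obeys `T < 2ℰ(u(0))/f₀`.
[cite: Miller2023StrainModel, Thm 1.11 and Def 1.7 (`E = ‖S‖²_{L²} = ½‖∇u‖²`)] -/
theorem _root_.Literature.Analysis.FluidPDE.Torus.IsStrainModelSolutionOn.time_lt_torusEnstrophy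
    (h : Torus.IsStrainModelSolutionOn (Icc 0 T) ν u) (hT : 0 < T) (hν : 0 ≤ ν)
    (hf₀ : 0 < -(3 * ν) * (2⁻¹ * ∫ x, ‖Torus.laplacian (u 0) x‖ ^ 2) -
      (4 / 3 : ℝ) * ∫ x, ∑ i, ∑ j, ∑ k,
        ((Torus.partialDeriv j (u 0) x i + Torus.partialDeriv i (u 0) x j) / 2) *
        ((Torus.partialDeriv k (u 0) x j + Torus.partialDeriv j (u 0) x k) / 2) *
        ((Torus.partialDeriv i (u 0) x k + Torus.partialDeriv k (u 0) x i) / 2)) :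
    T < 2 * torusEnstrophy (u 0) /
      (-(3 * ν) * (2⁻¹ * ∫ x, ‖Torus.laplacian (u 0) x‖ ^ 2) -
        (4 / 3 : ℝ) * ∫ x, ∑ i, ∑ j, ∑ k,
          ((Torus.partialDeriv j (u 0) x i + Torus.partialDeriv i (u 0) x j) / 2) *
          ((Torus.partialDeriv k (u 0) x j + Torus.partialDeriv j (u 0) x k) / 2) *
          ((Torus.partialDeriv i (u 0) x k + Torus.partialDeriv k (u 0) x i) / 2)) := by
  rw [← integral_strainNormSq_eq_torusEnstrophy (h.smooth.isSmooth_slice (Set.left_mem_Icc.2 hT.le))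
    (h.divFree (Set.left_mem_Icc.2 hT.le))]
  exact h.time_lt hT hν hf₀

end Blowup

end StrainModel

end Literature.Analysis.FluidPDE
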